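import Literature.NumberTheory.LFunctions.RodgersTaoGapsEnergyProofs
import Literature.NumberTheory.LFunctions.RodgersTaoRiemannVonMangoldtProofs
import Literature.NumberTheory.LFunctions.RodgersTaoGapsEnergy
import HarnessLib

/-!
# Rodgers–Tao 2020, Proposition 13 (= arXiv v4 Proposition 5.1, «lower bound on gaps»): the
# RH-free CONTENT, in house (time-translated) schema form

LABEL (cell rh-crit, corpus C3 = Rodgers–Tao/Dobner, seat rt-t2; trunk T-ANT
`Literature/NumberTheory/LFunctions`; LADDER-RH §1 COLUMN 3 DBN, bears_on N-C/N-P): **RH-FREE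
CONTENT.** Proofs only — NO definition, NO named fact. The printed Proposition 13
(`rodgers_tao_gap_bound` in `RodgersTaoGapsEnergy.lean`) is stated for `Λ/2 ≤ t ≤ 0` under the
paper's standing hypothesis `Λ < 0` and is therefore VACUOUS-AS-PRINTED in a tree that proves
`Λ ≥ 0` (`rodgers_tao_holds`); it is discharged there EX FALSO. The MATHEMATICS of its printed
proof (FMP pp. 37–38) is nevertheless RH-free real analysis about the zero flow of `H_t` on any time
interval above `Λ`, GIVEN the macroscopic location law (50) of Corollary 10 on that interval. This
file proves exactly that content:

* `rodgers_tao_gap_bound_of` — for `t₀ < t₁` with `H_{t₀}` real-rooted (so `Λ ≤ t₀`) and a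
  constant `B` with `|x_j(t) − ξ_j| ≤ B log₊ ξ_j` for all `j ≥ 1` and all `t ∈ [t₁, t₂]` (the shape
  of display (50)), there is `A`, UNIFORM in `t ∈ [t₁, t₂]`, with
  `H_{jk}(t) ≤ A · log₊² j · log₊ log₊ j` for all `j, k ∈ ℤ*`, `k ≠ j` — display (59);
* `rodgers_tao_gap_bound_of_cor33_location : cor33_location → rodgers_tao_gap_bound` — the
  printed statement follows from the printed Corollary 10 (50) (instance `[t₁, t₂] = [t₀/2, 0]`,
  `t₀ < 0` the §1.2 witness); an implication between two VACUOUS-AS-PRINTED facts whose proof is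
  the RH-free content above. No second `_holds` of `rodgers_tao_gap_bound` is recorded (its
  EX-FALSO discharge `rodgers_tao_gap_bound_holds` stands; cell ruling R2b).

The location law (50) at times `t > Λ ≥ 0` is NOT asserted here (it is Ki–Kim–Lee 2009 Thm 1.4 /
Polymath15 Thm 1.5 territory, not this paper's); the theorem is a SCHEMA in the same sense as the
§3 schemas `RodgersTao2020.cor33_location_of_count_estimate` / `cor33_order_of_location` /
`cor33_gaps_of_count_estimates`.

Source: B. Rodgers, T. Tao, *The de Bruijn–Newman constant is non-negative*, Forum Math. Pi 8
(2020) e6 (bib key `RodgersTaoFMP2020`) = arXiv:1801.05914. VERSION/PAGES OPENED (charter §3.2):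
arXiv v5 TeX `rh-crit/rt/src/RodgersTao_arXiv1801.05914v5.tex` l.842–937 (the whole of §5
«A weak bound on gaps»: Proposition 13 = v4 Prop. 5.1, display (59); Lemma 14 = v4 Lemma 5.2;
the proof with display (60)) and l.610–623 (Corollary 10 = v4 Cor. 3.3, (50)–(52)); FMP pp. 34–38.
Numbering: decl names follow the tree's v4 numbering (`rodgers_tao_gap_bound` = Prop. 5.1) with the
FMP/v5 numbers in every cite tag.

## Architecture (mirrors the printed proof, FMP pp. 37–38; one announced divergence)

The printed proof fixes `t`, sets `δ(K) := max_{k,k'∈K}|x_k − x_{k'}|` (the diameter of the zeros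
indexed by `K`), and argues: (1) by Lemma 14, a small `δ(K)` forces a large cross energy
`Σ_{k∈K, j∉K} E_{jk}`, hence (pigeonhole) one `k ∈ K` with large `Σ_{j∉K} E_{kj}`; (2) «from (52),
(58)» `Σ_{j∉K} E_{kj} ≪ 1 + (log²₊ ξ_k) min_{j∉K}|x_k − x_j|⁻²`, and for an interval
`K = [k₋, k₊]_{ℤ*}` the minimum is at least the smaller OUTER GAP
`min(|x_{k₋} − x_{k₋−1}|, |x_{k₊} − x_{k₊+1}|)`; (3) hence one of the two ENLARGEMENTS `K'` of `K`
has `δ(K') ≪ |K|³ log(k₊) δ(K)` (display (60)); (4) iterate from `K₁ = [j, j+1]` at most `log²₊ ξ_j`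
times; (5) the chain stops either because `δ(K_r)` is no longer small or because `K_r` is so wide
that (52) bounds its diameter below; (6) combine: `δ(K₁) ≥ exp(−O(log² j · log log j))`; bounded
`j` «by compactness».

* §0 — elementary `log₊` inequalities; `Σ_n log₊² n/n²` converges; the §3 inputs over the carriers
  of record (`lemma8_i_order` = `RodgersTao2020.lemma31_i_order_holds` via the R1c bridge
  `RodgersTao2020.logPlus = logPlus` (`rfl`), `lemma8_ii_pos` from `lemma31_ii_holds_record`).
* §A (step (2)) — `interactionEnergy_far_right/left/neg`, `sum_interactionEnergy_*_le`,
  `sum_interactionEnergy_compl_le`, `crossEnergy_interval_le`: for `K = [a, b]`, `2 ≤ a ≤ k ≤ b`,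
  and `0 < m ≤` both outer gaps, `Σ'_{j ∈ ℤ*∖K} E_{jk} ≤ Φ(b)/m² + C'` with
  `Φ(b) = 2(⌈2D log₊² b⌉ + ⌈4096 D²⌉ + ⌈log₊² b⌉) + ⌈1296 B⁴⌉`, `D = 16 B C₁²/c₂`,
  `C' = (32C₁²/c₂²)(2 + S₀) + (4/c₁²) S₀` (`c₁ ≤ C₁` the constants of Lemma 8 (i′), `c₂` of
  Lemma 8 (ii), `S₀ = Σ log₊² n/n²`). Near zeros (index distance `< N_b`) are bounded by `1/m²`;
  far zeros by the location law and the spacing (44) of the classical locations.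
* §B (steps (1)+(3)) — `outerGap_le_of_diam_small`: if `δ(K)² ≤ c_K/(2(C'+1))` then
  `m ≤ (2Φ(b)/c_K + 1) δ(K)`, `c_K` the (house) constant of Lemma 14
  (`rodgers_tao_gap_cross_energy_of_lt`, `RodgersTaoGapsEnergyProofs.lean`).
* §C (step (4)) — `min_le_growth_pow_mul_diam`: the chain `K₁ ⊂ K₂ ⊂ ⋯` as an induction on the
  number of remaining enlargements inside a window `[lo, hi]`.
* §D (step (5)) — `one_le_diam_of_wide`: an interval of width `≥ (2Λ/c₂)(1 + 2BΛ)`,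
  `Λ = C₁ log₊ hi`, has diameter `≥ 1`.
* §E (step (6), large `j`) — `exists_neg_log_gap_le_of_large`: with `N = ⌈C_N log₊² j⌉` steps,
  `C_N = 8C₁/c₂ + 16BC₁²/c₂`, for `j ≥ 4096 C_N² + 6`:
  `−log(x_{j+1} − x_j) ≤ A₁ log₊² j · log₊ log₊ j`, `A₁` explicit and uniform in `t`.
* §F — `hamiltonianInteraction_le_neg_log` (every other zero is a neighbouring gap away),
  `hamiltonianInteraction_neg_neg` (`j ↦ −j`), `exists_uniform_gap_lower` («compactness for
  bounded `j`»: `continuousAt_deBruijnZero` + `isCompact_Icc.exists_isMinOn`), and the two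
  theorems above.

DIVERGENCE from the printed proof (announced on rt/STATUS 10:07Z, ruling (42)): display (52)
(`x_k − x_j = 4π(k−j)/log₊ ξ_j + o(log₊ ξ_j)`) is NOT used. Both places where the source invokes it
— the environment bound of step (2) and the terminal lower bound of step (5) — only need that two
zeros whose indices differ by `i ≳ B·log₊² j` are `≫ i/log₊ ξ` apart, which follows from (50) and
Lemma 8 (ii) (44) with `O(log)` instead of `o(log)` errors; the price is that the chain runs
`C_N log₊² j` steps instead of `log₊² ξ_j` steps, which leaves the outcome
`exp(−O(log² j · log log j))` unchanged (the source itself remarks that any bound growing slower than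
`|j|^{0.1}` would do, p. 35). Also, step (3) is obtained without the factor `|K|³` of (60) (Lemma 14
gives `1 + Σ E ≥ c_K|K|/δ²` directly, since `Σ_{k≠k'}(x_k−x_{k'})² ≤ |K|²δ²`), which is harmless.
The constants of the source ("`≪`, depending on `Λ`") become explicit expressions in `B`, `c_K`
(hence in `t₁ − t₀`) and the absolute constants of Lemma 8; the bounded-`j` constant depends on the
time interval through the minimum of finitely many gaps, as in the source's compactness remark.

## References

* [RodgersTaoFMP2020] B. Rodgers, T. Tao, Forum Math. Pi 8 (2020) e6 = arXiv:1801.05914v4/v5: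
  §5 Proposition 13 (59), Lemma 14, display (60) and the proof, FMP pp. 34–38 (v5 TeX l.842–937);
  Corollary 10 (50), p. 23; Lemma 8 (43)–(44), p. 21; §1.2 (notation `log₊`, `ℤ*`, `[a,b]_{ℤ*}`), p. 7.
* G. Csordas, W. Smith, R. S. Varga, Constr. Approx. 10 (1994) — the source of Lemma 14's method
  («a variant of a result in [CSV]», p. 35); used here only through the tree's Lemma 14.

WHAT THIS IS NOT: not Proposition 13 at `t = 0` (that would need (50) at `t = 0`, i.e. RH-strength
input), not an assertion of (50) at any `t ≥ Λ`, not progress toward RH — formalising the corpus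
fixes vocabulary and which inputs a statement needs; nothing here bears on the truth of RH.
-/

noncomputable section

open Real Set Filter Topology

namespace Literature.NumberTheory.LFunctions

/-! ## §0. Elementary inequalities for `log₊` and the inputs of §3 over the carriers of record -/

/-- `log₊(x + y) ≤ log₊ x + log₊ y` for `x, y ≥ 0` (`2 + x + y ≤ (2 + x)(2 + y)`).
[cite: RodgersTaoFMP2020, §1.2 p. 7] -/
theorem logPlus_add_le {x y : ℝ} (hx : 0 ≤ x) (hy : 0 ≤ y) :
    logPlus (x + y) ≤ logPlus x + logPlus y := by
  rw [logPlus_eq, logPlus_eq, logPlus_eq, abs_of_nonneg hx, abs_of_nonneg hy,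
    abs_of_nonneg (add_nonneg hx hy), ← Real.log_mul (by linarith) (by linarith)]
  exact Real.log_le_log (by linarith) (by nlinarith)

/-- `log₊(2x) ≤ 2 log₊ x` for `x ≥ 0` (`2 + 2x ≤ (2 + x)²`). [cite: RodgersTaoFMP2020, §1.2 p. 7] -/
theorem logPlus_two_mul_le {x : ℝ} (hx : 0 ≤ x) : logPlus (2 * x) ≤ 2 * logPlus x := by
  rw [logPlus_eq, logPlus_eq, abs_of_nonneg hx, abs_of_nonneg (by linarith),
    ← Real.log_rpow (by linarith), Real.rpow_two]
  exact Real.log_le_log (by linarith) (by nlinarith)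

/-- `log₊(2x + 1) ≤ 2 log₊ x` for `x ≥ 0` (`3 + 2x ≤ (2 + x)²`). [cite: RodgersTaoFMP2020, §1.2 p. 7] -/
theorem logPlus_two_mul_add_one_le {x : ℝ} (hx : 0 ≤ x) : logPlus (2 * x + 1) ≤ 2 * logPlus x := by
  rw [logPlus_eq, logPlus_eq, abs_of_nonneg hx, abs_of_nonneg (by linarith),
    ← Real.log_rpow (by linarith), Real.rpow_two]
  exact Real.log_le_log (by linarith) (by nlinarith)

/-- `log y ≤ 4 √(√y)` for `y > 0` (`log y = 4 log y^{1/4} ≤ 4 (y^{1/4} − 1)`). [folklore] -/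
private theorem log_le_four_mul_sqrt_sqrt {y : ℝ} (hy : 0 < y) :
    Real.log y ≤ 4 * Real.sqrt (Real.sqrt y) := by
  have h1 : Real.log y = 4 * Real.log (Real.sqrt (Real.sqrt y)) := by
    rw [Real.log_sqrt (Real.sqrt_nonneg y), Real.log_sqrt hy.le]; ring
  have h2 : 0 < Real.sqrt (Real.sqrt y) := Real.sqrt_pos.2 (Real.sqrt_pos.2 hy)
  have h3 := Real.log_le_sub_one_of_pos h2
  rw [h1]; linarith

/-- `log₊² x ≤ 16 √(2 + |x|)`. [cite: RodgersTaoFMP2020, §1.2 p. 7] -/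
theorem logPlus_sq_le_sqrt (x : ℝ) : logPlus x ^ 2 ≤ 16 * Real.sqrt (2 + |x|) := by
  have h0 : 0 < 2 + |x| := by positivity
  have h1 := log_le_four_mul_sqrt_sqrt h0
  have h2 : 0 ≤ logPlus x := logPlus_nonneg x
  rw [logPlus_eq] at h2 ⊢
  have h3 : Real.sqrt (Real.sqrt (2 + |x|)) ^ 2 = Real.sqrt (2 + |x|) :=
    Real.sq_sqrt (Real.sqrt_nonneg _)
  nlinarith [Real.sqrt_nonneg (Real.sqrt (2 + |x|))]

/-- `log₊² n ≤ 32 √n` for a natural number `n ≥ 1` (`√(2 + n) ≤ √(3n) ≤ 2√n`).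
[cite: RodgersTaoFMP2020, §1.2 p. 7] -/
theorem logPlus_sq_le_sqrt_nat {n : ℝ} (hn : 1 ≤ n) : logPlus n ^ 2 ≤ 32 * Real.sqrt n := by
  have h1 := logPlus_sq_le_sqrt n
  rw [abs_of_nonneg (by linarith)] at h1
  have h2 : Real.sqrt (2 + n) ≤ 2 * Real.sqrt n := by
    rw [show (2 : ℝ) * Real.sqrt n = Real.sqrt (4 * n) by
      rw [Real.sqrt_mul (by norm_num), show Real.sqrt 4 = 2 by
        rw [show (4 : ℝ) = 2 ^ 2 by norm_num, Real.sqrt_sq (by norm_num)]]]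
    exact Real.sqrt_le_sqrt (by linarith)
  linarith

/-- The series `Σ_n log₊² n / n²` converges (comparison with `Σ n^{−3/2}`).
[cite: RodgersTaoFMP2020, §5 p. 37 (bookkeeping of the proof of Prop. 13)] -/
theorem summable_logPlus_sq_div_sq : Summable (fun n : ℕ ↦ logPlus n ^ 2 / (n : ℝ) ^ 2) := by
  have hs : Summable (fun n : ℕ ↦ 32 * ((n : ℝ) ^ (3 / 2 : ℝ))⁻¹) :=
    (Real.summable_nat_rpow_inv.2 (by norm_num)).mul_left 32
  refine hs.of_nonneg_of_le (fun n ↦ by positivity) fun n ↦ ?_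
  rcases Nat.eq_zero_or_pos n with rfl | hn
  · simp
  have hn1 : (1 : ℝ) ≤ n := by exact_mod_cast hn
  have hn0 : (0 : ℝ) < n := by linarith
  have h1 := logPlus_sq_le_sqrt_nat hn1
  have h2 : Real.sqrt n / (n : ℝ) ^ 2 = ((n : ℝ) ^ (3 / 2 : ℝ))⁻¹ := by
    rw [Real.sqrt_eq_rpow, ← Real.rpow_natCast, ← Real.rpow_neg hn0.le, div_eq_mul_inv,
      ← Real.rpow_neg hn0.le, ← Real.rpow_add hn0]
    norm_num
  calc logPlus n ^ 2 / (n : ℝ) ^ 2 ≤ 32 * Real.sqrt n / (n : ℝ) ^ 2 := by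
        gcongr
    _ = 32 * ((n : ℝ) ^ (3 / 2 : ℝ))⁻¹ := by rw [mul_div_assoc, h2]

/-- A finite-sum form of the previous lemma: there is `S₀` with `Σ_{n ∈ T} log₊² n / n² ≤ S₀` for
every finite `T ⊂ ℕ`. [cite: RodgersTaoFMP2020, §5 p. 37] -/
theorem exists_sum_logPlus_sq_div_sq_le :
    ∃ S₀ : ℝ, 0 ≤ S₀ ∧ ∀ T : Finset ℕ, ∑ n ∈ T, logPlus n ^ 2 / (n : ℝ) ^ 2 ≤ S₀ := by
  refine ⟨∑' n : ℕ, logPlus n ^ 2 / (n : ℝ) ^ 2, tsum_nonneg fun n ↦ by positivity, fun T ↦ ?_⟩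
  exact summable_logPlus_sq_div_sq.sum_le_tsum T fun n _ ↦ by positivity

/-! ### The inputs of §3 over the carriers of record (`logPlus`, `classicalLocation[Z]`,
`deBruijnZeroZ`) -/

/-- Lemma 8 (i′) (`ξ_y ≍ y/log₊ y`, `log₊ ξ_y ≍ log₊ y`, real `y ≥ 1`) over the root `logPlus`
(R1c bridge: `RodgersTao2020.logPlus = logPlus` by `rfl`).
[cite: RodgersTaoFMP2020, Lemma 8 (i) = v4 Lemma 3.1 (i) p. 21] -/
theorem lemma8_i_order :
    ∃ c C : ℝ, 0 < c ∧ c ≤ C ∧ ∀ y : ℝ, 1 ≤ y →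
      c * (y / logPlus y) ≤ classicalLocation y ∧ classicalLocation y ≤ C * (y / logPlus y) ∧
        c * logPlus y ≤ logPlus (classicalLocation y) ∧
          logPlus (classicalLocation y) ≤ C * logPlus y :=
  RodgersTao2020.lemma31_i_order_holds

/-- `ξ^{ℤ}_j = ξ_j` for a positive integer `j`. [cite: RodgersTaoFMP2020, §3 eq. (42) p. 21] -/
theorem classicalLocationZ_of_pos {j : ℤ} (hj : 0 < j) :
    classicalLocationZ j = classicalLocation (j : ℝ) :=
  RodgersTao2020.classicalLocationInt_of_pos hj

/-- Lemma 8 (ii) for positive integer indices: `c₂ (k − j)/log₊(ξ_j + ξ_k) ≤ ξ_k − ξ_j` for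
`1 ≤ j ≤ k`. [cite: RodgersTaoFMP2020, Lemma 8 (ii) = v4 Lemma 3.1 (ii) eq. (44) p. 21] -/
theorem lemma8_ii_pos :
    ∃ c : ℝ, 0 < c ∧ ∀ j k : ℤ, 1 ≤ j → j ≤ k →
      c * (((k : ℝ) - j) / logPlus (classicalLocation (j : ℝ) + classicalLocation (k : ℝ))) ≤
        classicalLocation (k : ℝ) - classicalLocation (j : ℝ) := by
  obtain ⟨c, C, hc, -, h⟩ := RodgersTao2020.lemma31_ii_holds_record
  refine ⟨c, hc, fun j k hj hjk ↦ ?_⟩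
  have hj0 : (0 : ℤ) < j := by omega
  have hk0 : (0 : ℤ) < k := by omega
  have h1 := (h j k hj0.ne' hk0.ne').1
  have hξj : 0 < classicalLocation (j : ℝ) := classicalLocation_pos (by exact_mod_cast (by omega : (-1 : ℤ) ≤ j))
  have hξk : 0 < classicalLocation (k : ℝ) := classicalLocation_pos (by exact_mod_cast (by omega : (-1 : ℤ) ≤ k))
  have hj1 : (-1 : ℝ) ≤ (j : ℝ) := by exact_mod_cast (by omega : (-1 : ℤ) ≤ j)
  have hk1 : (-1 : ℝ) ≤ (k : ℝ) := by exact_mod_cast (by omega : (-1 : ℤ) ≤ k)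
  have hmono : classicalLocation (j : ℝ) ≤ classicalLocation (k : ℝ) :=
    (strictMonoOn_classicalLocation.le_iff_le (Set.mem_Ici.2 hj1) (Set.mem_Ici.2 hk1)).2
      (by exact_mod_cast hjk)
  rw [classicalLocationZ_of_pos hj0, classicalLocationZ_of_pos hk0, abs_of_pos hξj, abs_of_pos hξk,
    abs_of_nonneg (sub_nonneg.2 hmono), abs_of_nonneg (by
      have : (j : ℝ) ≤ k := by exact_mod_cast hjk
      linarith)] at h1
  exact h1

/-- `x^{ℤ}_j(t) = x_{j.toNat}(t)` for `j ≥ 0`. [cite: RodgersTaoFMP2020, §1.2 p. 7] -/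
theorem deBruijnZeroZ_of_nonneg (t : ℝ) {j : ℤ} (hj : 0 ≤ j) :
    deBruijnZeroZ t j = deBruijnZero t j.toNat := by
  obtain ⟨n, rfl⟩ := Int.eq_ofNat_of_zero_le hj
  simp

/-- The location law (50) over `deBruijnZeroZ` for positive integer indices, from its `ℕ`-indexed
form. [cite: RodgersTaoFMP2020, Corollary 10 (50) = v4 Corollary 3.3 (50) p. 23] -/
theorem location_int_of_nat {t B : ℝ}
    (h50 : ∀ n : ℕ, 1 ≤ n →
      |deBruijnZero t n - classicalLocation (n : ℝ)| ≤ B * logPlus (classicalLocation (n : ℝ)))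
    {j : ℤ} (hj : 1 ≤ j) :
    |deBruijnZeroZ t j - classicalLocation (j : ℝ)| ≤ B * logPlus (classicalLocation (j : ℝ)) := by
  obtain ⟨n, rfl⟩ := Int.eq_ofNat_of_zero_le (by omega : (0 : ℤ) ≤ j)
  have hn : 1 ≤ n := by exact_mod_cast hj
  simpa using h50 n hn


/-- `log y ≤ 2 √y` for `y > 0`. [folklore] -/
private theorem log_le_two_mul_sqrt {y : ℝ} (hy : 0 < y) : Real.log y ≤ 2 * Real.sqrt y := by
  have h1 : Real.log y = 2 * Real.log (Real.sqrt y) := by rw [Real.log_sqrt hy.le]; ring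
  have h2 := Real.log_le_sub_one_of_pos (Real.sqrt_pos.2 hy)
  rw [h1]; linarith

/-- `log₊ ξ ≤ 3 √ξ` for `ξ ≥ 2` (`log(2 + ξ) ≤ 2√(2ξ) ≤ 3√ξ`). [folklore] -/
private theorem logPlus_le_three_mul_sqrt {ξ : ℝ} (hξ : 2 ≤ ξ) : logPlus ξ ≤ 3 * Real.sqrt ξ := by
  rw [logPlus_eq, abs_of_nonneg (by linarith)]
  have h1 := log_le_two_mul_sqrt (show (0 : ℝ) < 2 + ξ by linarith)
  have h2 : Real.sqrt (2 + ξ) ≤ Real.sqrt (2 * ξ) := Real.sqrt_le_sqrt (by linarith)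
  have h3 : Real.sqrt (2 * ξ) = Real.sqrt 2 * Real.sqrt ξ := Real.sqrt_mul (by norm_num) ξ
  have h4 : Real.sqrt 2 < 3 / 2 := by
    rw [Real.sqrt_lt' (by norm_num)]; norm_num
  have h5 : 0 ≤ Real.sqrt ξ := Real.sqrt_nonneg ξ
  nlinarith

/-- Telescoping bound `Σ_{N ≤ i < n} 1/(i+1)² ≤ 1/N` (`N ≥ 1`), in indicator form over
`Finset.range`. [folklore] -/
private theorem sum_range_indicator_inv_sq_le {N : ℕ} (hN : 1 ≤ N) (n : ℕ) :
    ∑ i ∈ Finset.range n, (if N ≤ i then 1 / ((i : ℝ) + 1) ^ 2 else 0) ≤ 1 / (N : ℝ) := by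
  have hN0 : (0 : ℝ) < N := by exact_mod_cast hN
  have main : ∀ m : ℕ, N ≤ m →
      ∑ i ∈ Finset.range m, (if N ≤ i then 1 / ((i : ℝ) + 1) ^ 2 else 0) ≤ 1 / (N : ℝ) - 1 / m := by
    intro m hm
    induction m, hm using Nat.le_induction with
    | base =>
        rw [Finset.sum_eq_zero fun i hi ↦ ?_]
        · simp
        · rw [Finset.mem_range] at hi
          simp [show ¬ N ≤ i from by omega]
    | succ m hm ih =>
        rw [Finset.sum_range_succ, if_pos hm]
        have hm0 : (0 : ℝ) < m := by exact_mod_cast (show 0 < m by omega)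
        have key : 1 / ((m : ℝ) + 1) ^ 2 ≤ 1 / (m : ℝ) - 1 / ((m : ℝ) + 1) := by
          rw [div_sub_div _ _ hm0.ne' (by positivity), div_le_div_iff₀ (by positivity) (by positivity)]
          nlinarith
        push_cast
        linarith
  rcases le_or_gt N n with h | h
  · have := main n h
    have : (0 : ℝ) ≤ 1 / n := by positivity
    linarith
  · rw [Finset.sum_eq_zero fun i hi ↦ ?_]
    · positivity
    · rw [Finset.mem_range] at hi
      simp [show ¬ N ≤ i from by omega]

/-- Counting bound: `Σ_{i < n} [i < N] c ≤ N c` for `c ≥ 0`. [folklore] -/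
private theorem sum_range_indicator_const_le {c : ℝ} (hc : 0 ≤ c) (N n : ℕ) :
    ∑ i ∈ Finset.range n, (if i < N then c else 0) ≤ N * c := by
  rw [Finset.sum_ite, Finset.sum_const_zero, add_zero, Finset.sum_const, nsmul_eq_mul]
  gcongr
  calc ((Finset.range n).filter (· < N)).card ≤ (Finset.range N).card :=
        Finset.card_le_card fun i hi ↦ by
          rw [Finset.mem_filter] at hi; exact Finset.mem_range.2 hi.2
    _ = N := Finset.card_range N

/-! ## §A. The environment energy of an interval (proof of Prop. 13, FMP p. 37:
«from (52), (58) we have `Σ_{j ∉ K} E_{kj} ≪ 1 + (log²₊ ξ_k) min_{j ∉ K} |x_k − x_j|⁻²`»)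

Here WITHOUT (52): the location law (50) and Lemma 8 (i′), (ii) suffice. Throughout, `K = [a, b]`
with `2 ≤ a ≤ k ≤ b`, the outer gaps are `x_a − x_{a−1}` and `x_{b+1} − x_b`, and the constants
`c₁ ≤ C₁` (Lemma 8 (i′)), `c₂` (Lemma 8 (ii)) and `B` ((50)) are carried as hypotheses. -/

section EnvEnergy

variable {t B c₁ C₁ c₂ : ℝ}

/-- A zero to the right of the interval is at least the right outer gap away from every zero of the
interval: `x_{b+1} − x_b ≤ x_j − x_k` for `k ≤ b < j`. [cite: RodgersTaoFMP2020, §5 p. 37] -/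
theorem outerGap_right_le_sub (hΛ : ∃ t₁ : ℝ, t₁ < t ∧ HasOnlyRealZeros (deBruijnH t₁))
    {k b j : ℤ} (hkb : k ≤ b) (hbj : b < j) :
    deBruijnZeroZ t (b + 1) - deBruijnZeroZ t b ≤ deBruijnZeroZ t j - deBruijnZeroZ t k := by
  have hmono := (strictMono_deBruijnZeroZ hΛ).monotone
  linarith [hmono hkb, hmono (show b + 1 ≤ j by omega)]

/-- A zero to the left of the interval (index `j < a`, any sign) is at least the left outer gap away
from every zero of the interval: `x_a − x_{a−1} ≤ x_k − x_j` for `j < a ≤ k`.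
[cite: RodgersTaoFMP2020, §5 p. 37] -/
theorem outerGap_left_le_sub (hΛ : ∃ t₁ : ℝ, t₁ < t ∧ HasOnlyRealZeros (deBruijnH t₁))
    {k a j : ℤ} (hak : a ≤ k) (hja : j < a) :
    deBruijnZeroZ t a - deBruijnZeroZ t (a - 1) ≤ deBruijnZeroZ t k - deBruijnZeroZ t j := by
  have hmono := (strictMono_deBruijnZeroZ hΛ).monotone
  linarith [hmono hak, hmono (show j ≤ a - 1 by omega)]

/-- The trivial bound `E_{jk} ≤ 1/m²` whenever `0 < m ≤ |x_j − x_k|`.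
[cite: RodgersTaoFMP2020, §4 (58) p. 29] -/
theorem interactionEnergy_le_inv_sq {t m : ℝ} {j k : ℤ} (hm : 0 < m)
    (h : m ≤ |deBruijnZeroZ t j - deBruijnZeroZ t k|) :
    interactionEnergy t j k ≤ 1 / m ^ 2 := by
  rw [interactionEnergy_eq, ← sq_abs]
  exact one_div_le_one_div_of_le (by positivity) (pow_le_pow_left₀ hm.le h 2)

/-- `ξ_j ≥ √j` for `j ≥ 1` (from `j ≤ ξ_j²`). [cite: RodgersTaoFMP2020, Lemma 8 (i) (proof) p. 21] -/
theorem sqrt_le_classicalLocation {y : ℝ} (hy : 1 ≤ y) : Real.sqrt y ≤ classicalLocation y := by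
  have h := RodgersTao2020.le_classicalLocation_sq hy
  have hξ : 0 ≤ classicalLocation y := (classicalLocation_pos (by linarith)).le
  calc Real.sqrt y ≤ Real.sqrt (classicalLocation y ^ 2) := Real.sqrt_le_sqrt h
    _ = classicalLocation y := Real.sqrt_sq hξ

/-- `log₊ ξ_b ≤ log₊ ξ_j` for `1 ≤ b ≤ j` (monotonicity of `ξ` and `log₊`).
[cite: RodgersTaoFMP2020, §3 p. 21] -/
theorem logPlus_classicalLocation_mono {b j : ℝ} (hb : 1 ≤ b) (hbj : b ≤ j) :
    logPlus (classicalLocation b) ≤ logPlus (classicalLocation j) := by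
  have hb1 : (-1 : ℝ) ≤ b := by linarith
  have hj1 : (-1 : ℝ) ≤ j := by linarith
  have hmono : classicalLocation b ≤ classicalLocation j :=
    (strictMonoOn_classicalLocation.le_iff_le (Set.mem_Ici.2 hb1) (Set.mem_Ici.2 hj1)).2 hbj
  exact logPlus_mono (by rw [abs_of_pos (classicalLocation_pos hb1),
    abs_of_pos (classicalLocation_pos hj1)]; exact hmono)

/-- `log₊(ξ_b + ξ_j) ≤ 2 log₊ ξ_j` for `1 ≤ b ≤ j`. [cite: RodgersTaoFMP2020, §3 p. 21] -/
theorem logPlus_classicalLocation_add_le {b j : ℝ} (hb : 1 ≤ b) (hbj : b ≤ j) :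
    logPlus (classicalLocation b + classicalLocation j) ≤ 2 * logPlus (classicalLocation j) := by
  have hb1 : (-1 : ℝ) ≤ b := by linarith
  have hj1 : (-1 : ℝ) ≤ j := by linarith
  have hmono : classicalLocation b ≤ classicalLocation j :=
    (strictMonoOn_classicalLocation.le_iff_le (Set.mem_Ici.2 hb1) (Set.mem_Ici.2 hj1)).2 hbj
  have hξb := classicalLocation_pos hb1
  have hξj := classicalLocation_pos hj1
  calc logPlus (classicalLocation b + classicalLocation j)
      ≤ logPlus (2 * classicalLocation j) :=
        logPlus_mono (by rw [abs_of_pos (by positivity), abs_of_pos (by positivity)]; linarith)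
    _ ≤ 2 * logPlus (classicalLocation j) := logPlus_two_mul_le hξj.le

/-- FAR REGIME, RIGHT: for `j = b + i` with `i` beyond the threshold
(`2D log₊² b ≤ i`, `4096 D² ≤ i`, `D = 16 B C₁²/c₂`), the location law and Lemma 8 give
`x_j − x_b ≥ c₂ i/(4 log₊ ξ_j)` and hence `E_{jk} ≤ (32 C₁²/c₂²)(log₊² b + log₊² i)/i²` for every
`k ≤ b`. [cite: RodgersTaoFMP2020, §5 p. 37 (environment bound in the proof of Prop. 13)] -/
theorem interactionEnergy_far_right (hΛ : ∃ t₁ : ℝ, t₁ < t ∧ HasOnlyRealZeros (deBruijnH t₁))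
    (hB : 0 ≤ B)
    (h50 : ∀ j : ℤ, 1 ≤ j →
      |deBruijnZeroZ t j - classicalLocation (j : ℝ)| ≤ B * logPlus (classicalLocation (j : ℝ)))
    (hC₁ : 0 < C₁) (hord : ∀ y : ℝ, 1 ≤ y → logPlus (classicalLocation y) ≤ C₁ * logPlus y)
    (hc₂ : 0 < c₂)
    (hii : ∀ j k : ℤ, 1 ≤ j → j ≤ k →
      c₂ * (((k : ℝ) - j) / logPlus (classicalLocation (j : ℝ) + classicalLocation (k : ℝ))) ≤
        classicalLocation (k : ℝ) - classicalLocation (j : ℝ))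
    {k b : ℤ} (hb : 1 ≤ b) (hkb : k ≤ b) {i : ℕ} (hi1 : 1 ≤ i)
    (hiD : 2 * (16 * B * C₁ ^ 2 / c₂) * logPlus b ^ 2 ≤ i)
    (hiD' : 4096 * (16 * B * C₁ ^ 2 / c₂) ^ 2 ≤ i) :
    interactionEnergy t (b + i) k ≤
      32 * C₁ ^ 2 / c₂ ^ 2 * ((logPlus b ^ 2 + logPlus i ^ 2) / (i : ℝ) ^ 2) := by
  set D : ℝ := 16 * B * C₁ ^ 2 / c₂ with hD
  have hD0 : 0 ≤ D := by rw [hD]; positivity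
  set j : ℤ := b + i with hj
  have hbj : b ≤ j := by omega
  have hj1 : (1 : ℤ) ≤ j := by omega
  have hbR : (1 : ℝ) ≤ b := by exact_mod_cast hb
  have hjR : (b : ℝ) ≤ j := by exact_mod_cast hbj
  have hi0 : (0 : ℝ) < i := by exact_mod_cast hi1
  have hiR : (1 : ℝ) ≤ i := by exact_mod_cast hi1
  have hji : (j : ℝ) - b = i := by rw [hj]; push_cast; ring
  set Lj : ℝ := logPlus (classicalLocation (j : ℝ)) with hLj
  have hLj0 : 0 < Lj := logPlus_pos _
  -- Lemma 8 (ii) and the location law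
  have h1 := hii b j hb hbj
  rw [hji] at h1
  have h2 : logPlus (classicalLocation (b : ℝ) + classicalLocation (j : ℝ)) ≤ 2 * Lj :=
    logPlus_classicalLocation_add_le hbR hjR
  have h3 : c₂ * i / (2 * Lj) ≤ classicalLocation (j : ℝ) - classicalLocation (b : ℝ) := by
    refine le_trans ?_ h1
    rw [mul_div_assoc]
    exact mul_le_mul_of_nonneg_left
      (div_le_div_of_nonneg_left hi0.le (logPlus_pos _) h2) hc₂.le
  have h4 := h50 j hj1
  have h5 := h50 b hb
  have h6 : logPlus (classicalLocation (b : ℝ)) ≤ Lj := logPlus_classicalLocation_mono hbR hjR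
  have h7 : c₂ * i / (2 * Lj) - 2 * B * Lj ≤ deBruijnZeroZ t j - deBruijnZeroZ t b := by
    obtain ⟨h4a, h4b⟩ := abs_le.1 h4
    obtain ⟨h5a, h5b⟩ := abs_le.1 h5
    have h6' : B * logPlus (classicalLocation (b : ℝ)) ≤ B * Lj := mul_le_mul_of_nonneg_left h6 hB
    linarith
  -- the threshold: 8 B Lj² ≤ c₂ i
  have h8 : Lj ≤ C₁ * (logPlus b + logPlus i) := by
    have := hord (j : ℝ) (by exact_mod_cast hj1)
    refine this.trans (mul_le_mul_of_nonneg_left ?_ hC₁.le)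
    have : (j : ℝ) = b + i := by rw [hj]; push_cast; ring
    rw [this]
    exact logPlus_add_le (by linarith) hi0.le
  have hLb0 : 0 ≤ logPlus (b : ℝ) := logPlus_nonneg _
  have hLi0 : 0 ≤ logPlus (i : ℝ) := logPlus_nonneg _
  have e5 : Lj ^ 2 ≤ 2 * C₁ ^ 2 * (logPlus (b : ℝ) ^ 2 + logPlus i ^ 2) := by
    have h8' := pow_le_pow_left₀ hLj0.le h8 2
    have : (C₁ * (logPlus (b : ℝ) + logPlus i)) ^ 2 ≤ 2 * C₁ ^ 2 * (logPlus (b : ℝ) ^ 2 + logPlus i ^ 2) := by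
      rw [mul_pow]
      have : (logPlus (b : ℝ) + logPlus i) ^ 2 ≤ 2 * (logPlus (b : ℝ) ^ 2 + logPlus i ^ 2) := by
        nlinarith [sq_nonneg (logPlus (b : ℝ) - logPlus i)]
      nlinarith [sq_nonneg C₁]
    exact h8'.trans this
  have h9 : logPlus (i : ℝ) ^ 2 ≤ 32 * Real.sqrt i := logPlus_sq_le_sqrt_nat hiR
  have h10 : 64 * D ≤ Real.sqrt i := by
    have : Real.sqrt (4096 * D ^ 2) = 64 * D := by
      rw [show (4096 : ℝ) * D ^ 2 = (64 * D) ^ 2 by ring, Real.sqrt_sq (by positivity)]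
    rw [← this]
    exact Real.sqrt_le_sqrt hiD'
  have h11 : D * logPlus (i : ℝ) ^ 2 ≤ i / 2 := by
    have hs : Real.sqrt (i : ℝ) * Real.sqrt i = i := Real.mul_self_sqrt hi0.le
    have hs0 : 0 ≤ Real.sqrt (i : ℝ) := Real.sqrt_nonneg _
    have e1 : D * logPlus (i : ℝ) ^ 2 ≤ D * (32 * Real.sqrt i) := mul_le_mul_of_nonneg_left h9 hD0
    have e2 : 64 * D * Real.sqrt i ≤ Real.sqrt i * Real.sqrt i :=
      mul_le_mul_of_nonneg_right h10 hs0
    linarith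
  have h12 : 8 * B * Lj ^ 2 ≤ c₂ * i := by
    have e1 : 8 * B * Lj ^ 2 ≤ 8 * B * (2 * C₁ ^ 2 * (logPlus (b : ℝ) ^ 2 + logPlus i ^ 2)) :=
      mul_le_mul_of_nonneg_left e5 (by positivity)
    have e3 : 8 * B * (2 * C₁ ^ 2 * (logPlus (b : ℝ) ^ 2 + logPlus i ^ 2)) =
        c₂ * (D * logPlus b ^ 2 + D * logPlus i ^ 2) := by
      rw [hD]; field_simp; ring
    have e4 : D * logPlus (b : ℝ) ^ 2 ≤ i / 2 := by linarith
    have e6 : c₂ * (D * logPlus (b : ℝ) ^ 2 + D * logPlus i ^ 2) ≤ c₂ * i :=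
      mul_le_mul_of_nonneg_left (by linarith) hc₂.le
    linarith
  -- hence x_j − x_b ≥ c₂ i/(4 Lj) > 0
  have h13 : 2 * B * Lj ≤ c₂ * i / (4 * Lj) := by
    rw [le_div_iff₀ (by positivity)]; nlinarith
  have h14 : c₂ * i / (4 * Lj) ≤ deBruijnZeroZ t j - deBruijnZeroZ t b := by
    have : c₂ * i / (2 * Lj) = 2 * (c₂ * i / (4 * Lj)) := by field_simp; ring
    linarith
  have hd : 0 < c₂ * i / (4 * Lj) := by positivity
  have h15 : c₂ * i / (4 * Lj) ≤ |deBruijnZeroZ t j - deBruijnZeroZ t k| := by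
    refine h14.trans ((le_abs_self _).trans' ?_)
    have hmono := (strictMono_deBruijnZeroZ hΛ).monotone hkb
    linarith
  have h16 := interactionEnergy_le_inv_sq hd h15
  refine h16.trans ?_
  have e7 : 1 / (c₂ * i / (4 * Lj)) ^ 2 = 16 * Lj ^ 2 / (c₂ ^ 2 * i ^ 2) := by
    field_simp; ring
  have e8 : 16 * Lj ^ 2 / (c₂ ^ 2 * (i : ℝ) ^ 2) ≤
      32 * C₁ ^ 2 * (logPlus (b : ℝ) ^ 2 + logPlus i ^ 2) / (c₂ ^ 2 * i ^ 2) :=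
    div_le_div_of_nonneg_right (by linarith) (by positivity)
  rw [e7]
  refine e8.trans (le_of_eq ?_)
  ring


/-- FAR REGIME, LEFT: for `j = a − i ≥ 1` with `2D log₊² b ≤ i` (`D = 16 B C₁²/c₂`, `a ≤ b`), the
location law and Lemma 8 give `x_a − x_j ≥ c₂ i/(4 log₊ ξ_a)` and hence
`E_{jk} ≤ (32 C₁²/c₂²) log₊² b / i²` for every `k ≥ a`.
[cite: RodgersTaoFMP2020, §5 p. 37 (environment bound in the proof of Prop. 13)] -/
theorem interactionEnergy_far_left (hΛ : ∃ t₁ : ℝ, t₁ < t ∧ HasOnlyRealZeros (deBruijnH t₁))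
    (hB : 0 ≤ B)
    (h50 : ∀ j : ℤ, 1 ≤ j →
      |deBruijnZeroZ t j - classicalLocation (j : ℝ)| ≤ B * logPlus (classicalLocation (j : ℝ)))
    (hC₁ : 0 < C₁) (hord : ∀ y : ℝ, 1 ≤ y → logPlus (classicalLocation y) ≤ C₁ * logPlus y)
    (hc₂ : 0 < c₂)
    (hii : ∀ j k : ℤ, 1 ≤ j → j ≤ k →
      c₂ * (((k : ℝ) - j) / logPlus (classicalLocation (j : ℝ) + classicalLocation (k : ℝ))) ≤
        classicalLocation (k : ℝ) - classicalLocation (j : ℝ))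
    {k a b : ℤ} (hak : a ≤ k) (hab : a ≤ b) {i : ℕ} (hi1 : 1 ≤ i) (hia : 1 ≤ a - i)
    (hiD : 2 * (16 * B * C₁ ^ 2 / c₂) * logPlus b ^ 2 ≤ i) :
    interactionEnergy t (a - i) k ≤ 32 * C₁ ^ 2 / c₂ ^ 2 * (logPlus b ^ 2 / (i : ℝ) ^ 2) := by
  set D : ℝ := 16 * B * C₁ ^ 2 / c₂ with hD
  have hD0 : 0 ≤ D := by rw [hD]; positivity
  set j : ℤ := a - i with hj
  have hja : j ≤ a := by omega
  have ha1 : (1 : ℤ) ≤ a := by omega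
  have hjR1 : (1 : ℝ) ≤ j := by exact_mod_cast hia
  have hjR : (j : ℝ) ≤ a := by exact_mod_cast hja
  have haR : (1 : ℝ) ≤ a := by exact_mod_cast ha1
  have hi0 : (0 : ℝ) < i := by exact_mod_cast hi1
  have hji : (a : ℝ) - j = i := by rw [hj]; push_cast; ring
  set La : ℝ := logPlus (classicalLocation (a : ℝ)) with hLa
  have hLa0 : 0 < La := logPlus_pos _
  have h1 := hii j a hia hja
  rw [hji] at h1
  have h2 : logPlus (classicalLocation (j : ℝ) + classicalLocation (a : ℝ)) ≤ 2 * La :=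
    logPlus_classicalLocation_add_le hjR1 hjR
  have h3 : c₂ * i / (2 * La) ≤ classicalLocation (a : ℝ) - classicalLocation (j : ℝ) := by
    refine le_trans ?_ h1
    rw [mul_div_assoc]
    exact mul_le_mul_of_nonneg_left
      (div_le_div_of_nonneg_left hi0.le (logPlus_pos _) h2) hc₂.le
  have h4 := h50 j hia
  have h5 := h50 a ha1
  have h6 : logPlus (classicalLocation (j : ℝ)) ≤ La := logPlus_classicalLocation_mono hjR1 hjR
  have h7 : c₂ * i / (2 * La) - 2 * B * La ≤ deBruijnZeroZ t a - deBruijnZeroZ t j := by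
    obtain ⟨h4a, h4b⟩ := abs_le.1 h4
    obtain ⟨h5a, h5b⟩ := abs_le.1 h5
    have h6' : B * logPlus (classicalLocation (j : ℝ)) ≤ B * La := mul_le_mul_of_nonneg_left h6 hB
    linarith
  have h8 : La ≤ C₁ * logPlus b := by
    have := hord (a : ℝ) haR
    refine this.trans (mul_le_mul_of_nonneg_left (logPlus_mono ?_) hC₁.le)
    rw [abs_of_pos (by linarith), abs_of_pos (by exact_mod_cast (show (0 : ℤ) < b by omega))]
    exact_mod_cast hab
  have hLb0 : 0 ≤ logPlus (b : ℝ) := logPlus_nonneg _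
  have e5 : La ^ 2 ≤ C₁ ^ 2 * logPlus (b : ℝ) ^ 2 := by
    rw [← mul_pow]; exact pow_le_pow_left₀ hLa0.le h8 2
  have h12 : 8 * B * La ^ 2 ≤ c₂ * i := by
    have e1 : 8 * B * La ^ 2 ≤ 8 * B * (C₁ ^ 2 * logPlus (b : ℝ) ^ 2) :=
      mul_le_mul_of_nonneg_left e5 (by positivity)
    have e3 : 8 * B * (C₁ ^ 2 * logPlus (b : ℝ) ^ 2) = c₂ * (D * logPlus b ^ 2) / 2 := by
      rw [hD]; field_simp; ring
    have e4 : D * logPlus (b : ℝ) ^ 2 ≤ i / 2 := by linarith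
    have e6 : c₂ * (D * logPlus (b : ℝ) ^ 2) / 2 ≤ c₂ * i := by
      rw [div_le_iff₀ (by norm_num : (0:ℝ) < 2)]
      have := mul_le_mul_of_nonneg_left e4 hc₂.le
      nlinarith
    linarith
  have h13 : 2 * B * La ≤ c₂ * i / (4 * La) := by
    rw [le_div_iff₀ (by positivity)]; nlinarith
  have h14 : c₂ * i / (4 * La) ≤ deBruijnZeroZ t a - deBruijnZeroZ t j := by
    have : c₂ * i / (2 * La) = 2 * (c₂ * i / (4 * La)) := by field_simp; ring
    linarith
  have hd : 0 < c₂ * i / (4 * La) := by positivity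
  have h15 : c₂ * i / (4 * La) ≤ |deBruijnZeroZ t j - deBruijnZeroZ t k| := by
    rw [abs_sub_comm]
    refine h14.trans ((le_abs_self _).trans' ?_)
    have hmono := (strictMono_deBruijnZeroZ hΛ).monotone hak
    linarith
  have h16 := interactionEnergy_le_inv_sq hd h15
  refine h16.trans ?_
  have e7 : 1 / (c₂ * i / (4 * La)) ^ 2 = 16 * La ^ 2 / (c₂ ^ 2 * i ^ 2) := by
    field_simp; ring
  have e8 : 16 * La ^ 2 / (c₂ ^ 2 * (i : ℝ) ^ 2) ≤
      32 * C₁ ^ 2 * logPlus (b : ℝ) ^ 2 / (c₂ ^ 2 * i ^ 2) :=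
    div_le_div_of_nonneg_right (by nlinarith) (by positivity)
  rw [e7]
  refine e8.trans (le_of_eq ?_)
  ring

/-- FAR REGIME, NEGATIVE SIDE: for `n ≥ 1296 B⁴` (so that `B log₊ ξ_n ≤ ξ_n/2`) and `k ≥ 1`,
`x_k − x_{−n} = x_k + x_n ≥ x_n ≥ ξ_n/2 ≥ (c₁/2) n/log₊ n`, hence
`E_{(−n)k} ≤ 4 log₊² n/(c₁² n²)`. [cite: RodgersTaoFMP2020, §5 p. 37 (environment bound in the proof of Prop. 13)] -/
theorem interactionEnergy_far_neg (hΛ : ∃ t₁ : ℝ, t₁ < t ∧ HasOnlyRealZeros (deBruijnH t₁))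
    (hB : 0 ≤ B)
    (h50 : ∀ j : ℤ, 1 ≤ j →
      |deBruijnZeroZ t j - classicalLocation (j : ℝ)| ≤ B * logPlus (classicalLocation (j : ℝ)))
    (hc₁ : 0 < c₁) (hordl : ∀ y : ℝ, 1 ≤ y → c₁ * (y / logPlus y) ≤ classicalLocation y)
    {k : ℤ} (hk : 1 ≤ k) {n : ℕ} (hn1 : 1 ≤ n) (hnB : 1296 * B ^ 4 ≤ n) :
    interactionEnergy t (-(n : ℤ)) k ≤ 4 / c₁ ^ 2 * (logPlus n ^ 2 / (n : ℝ) ^ 2) := by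
  have hnR : (1 : ℝ) ≤ n := by exact_mod_cast hn1
  have hn0 : (0 : ℝ) < n := by linarith
  set ξ : ℝ := classicalLocation (n : ℝ) with hξ
  have hξ4 : 4 * π ≤ ξ := four_pi_le_classicalLocation (by linarith)
  have hξ2 : 2 ≤ ξ := by linarith [Real.pi_gt_three]
  have hξ0 : 0 < ξ := by linarith
  -- B log₊ ξ_n ≤ ξ_n / 2
  have h1 : logPlus ξ ≤ 3 * Real.sqrt ξ := logPlus_le_three_mul_sqrt hξ2
  have h2 : 36 * B ^ 2 ≤ ξ := by
    have e1 : Real.sqrt (n : ℝ) ≤ ξ := sqrt_le_classicalLocation hnR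
    have e2 : Real.sqrt (1296 * B ^ 4) ≤ Real.sqrt n := Real.sqrt_le_sqrt hnB
    have e3 : Real.sqrt (1296 * B ^ 4) = 36 * B ^ 2 := by
      rw [show (1296 : ℝ) * B ^ 4 = (36 * B ^ 2) ^ 2 by ring, Real.sqrt_sq (by positivity)]
    linarith
  have h3 : 6 * B ≤ Real.sqrt ξ := by
    have e3 : Real.sqrt (36 * B ^ 2) = 6 * B := by
      rw [show (36 : ℝ) * B ^ 2 = (6 * B) ^ 2 by ring, Real.sqrt_sq (by positivity)]
    rw [← e3]; exact Real.sqrt_le_sqrt h2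
  have h4 : B * logPlus ξ ≤ ξ / 2 := by
    have hs : Real.sqrt ξ * Real.sqrt ξ = ξ := Real.mul_self_sqrt hξ0.le
    have hs0 : 0 ≤ Real.sqrt ξ := Real.sqrt_nonneg _
    have e1 : B * logPlus ξ ≤ B * (3 * Real.sqrt ξ) := mul_le_mul_of_nonneg_left h1 hB
    have e2 : 6 * B * Real.sqrt ξ ≤ Real.sqrt ξ * Real.sqrt ξ := mul_le_mul_of_nonneg_right h3 hs0
    linarith
  -- x_n ≥ ξ_n / 2 ≥ (c₁/2) n / log₊ n
  have h5 := h50 n (by exact_mod_cast hn1)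
  have h6 : ξ / 2 ≤ deBruijnZeroZ t n := by
    obtain ⟨h5a, -⟩ := abs_le.1 h5
    push_cast at h5a
    linarith
  have h7 : c₁ * (n / logPlus n) / 2 ≤ deBruijnZeroZ t n := by
    have := hordl (n : ℝ) hnR; linarith
  have hd : 0 < c₁ * (n / logPlus n) / 2 := by
    have := logPlus_pos (n : ℝ); positivity
  have hxk : 0 < deBruijnZeroZ t k := deBruijnZeroZ_pos hΛ (by omega)
  have h8 : c₁ * (n / logPlus n) / 2 ≤ |deBruijnZeroZ t (-(n : ℤ)) - deBruijnZeroZ t k| := by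
    rw [deBruijnZeroZ_neg, abs_sub_comm, sub_neg_eq_add]
    refine h7.trans ((le_abs_self _).trans' (by linarith))
  refine (interactionEnergy_le_inv_sq hd h8).trans (le_of_eq ?_)
  have := (logPlus_pos (n : ℝ)).ne'
  field_simp
  ring

/-- `Σ_{s ∪ u} f ≤ Σ_s f + Σ_u f` for a non-negative `f`. [folklore] -/
private theorem sum_union_le_add {f : ℤ → ℝ} (hf : ∀ j, 0 ≤ f j) (s u : Finset ℤ) :
    ∑ j ∈ s ∪ u, f j ≤ ∑ j ∈ s, f j + ∑ j ∈ u, f j := by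
  classical
  rw [← Finset.sum_union_inter]
  have : 0 ≤ ∑ j ∈ s ∩ u, f j := Finset.sum_nonneg fun j _ ↦ hf j
  linarith


/-- RIGHT-SIDE SUM: for `K = [a, b]` (`2 ≤ a ≤ k ≤ b`) and any `0 < m` below both outer gaps,
`Σ_{i < n} E_{(b+1+i)k} ≤ N_b/m² + (32 C₁²/c₂²)(1 + S₀)` with
`N_b = ⌈2D log₊² b⌉ + ⌈4096 D²⌉ + ⌈log₊² b⌉` (near zeros trivially, far zeros by
`interactionEnergy_far_right`). [cite: RodgersTaoFMP2020, §5 p. 37 (environment bound in the proof of Prop. 13)] -/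
theorem sum_interactionEnergy_right_le (hΛ : ∃ t₁ : ℝ, t₁ < t ∧ HasOnlyRealZeros (deBruijnH t₁))
    (hB : 0 ≤ B)
    (h50 : ∀ j : ℤ, 1 ≤ j →
      |deBruijnZeroZ t j - classicalLocation (j : ℝ)| ≤ B * logPlus (classicalLocation (j : ℝ)))
    (hC₁ : 0 < C₁) (hord : ∀ y : ℝ, 1 ≤ y → logPlus (classicalLocation y) ≤ C₁ * logPlus y)
    (hc₂ : 0 < c₂)
    (hii : ∀ j k : ℤ, 1 ≤ j → j ≤ k →
      c₂ * (((k : ℝ) - j) / logPlus (classicalLocation (j : ℝ) + classicalLocation (k : ℝ))) ≤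
        classicalLocation (k : ℝ) - classicalLocation (j : ℝ))
    {S₀ : ℝ} (hS₀ : ∀ T : Finset ℕ, ∑ n ∈ T, logPlus n ^ 2 / (n : ℝ) ^ 2 ≤ S₀)
    {k b : ℤ} (hb : 1 ≤ b) (hkb : k ≤ b) {m : ℝ} (hm : 0 < m)
    (hmR : m ≤ deBruijnZeroZ t (b + 1) - deBruijnZeroZ t b) (n : ℕ) :
    ∑ i ∈ Finset.range n, interactionEnergy t (b + 1 + i) k ≤
      ((⌈2 * (16 * B * C₁ ^ 2 / c₂) * logPlus b ^ 2⌉₊ + ⌈4096 * (16 * B * C₁ ^ 2 / c₂) ^ 2⌉₊ +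
          ⌈logPlus b ^ 2⌉₊ : ℕ) : ℝ) / m ^ 2 + 32 * C₁ ^ 2 / c₂ ^ 2 * (1 + S₀) := by
  set D : ℝ := 16 * B * C₁ ^ 2 / c₂ with hD
  set N : ℕ := ⌈2 * D * logPlus b ^ 2⌉₊ + ⌈4096 * D ^ 2⌉₊ + ⌈logPlus b ^ 2⌉₊ with hN
  set c : ℝ := 32 * C₁ ^ 2 / c₂ ^ 2 with hc
  have hc0 : 0 ≤ c := by rw [hc]; positivity
  have hLb : 0 < logPlus (b : ℝ) := logPlus_pos _
  have hN1 : 1 ≤ N := by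
    have : 1 ≤ ⌈logPlus (b : ℝ) ^ 2⌉₊ := Nat.one_le_ceil_iff.2 (by positivity)
    omega
  have hNR : logPlus (b : ℝ) ^ 2 ≤ N := by
    rw [hN]; push_cast
    have h1 := Nat.le_ceil (logPlus (b : ℝ) ^ 2)
    have h2 : (0 : ℝ) ≤ ⌈2 * D * logPlus (b : ℝ) ^ 2⌉₊ := by positivity
    have h3 : (0 : ℝ) ≤ ⌈4096 * D ^ 2⌉₊ := by positivity
    linarith
  -- termwise majorant
  have hterm : ∀ i ∈ Finset.range n, interactionEnergy t (b + 1 + i) k ≤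
      (if i < N then 1 / m ^ 2 else 0) +
        c * (logPlus b ^ 2 * (if N ≤ i then 1 / ((i : ℝ) + 1) ^ 2 else 0)) +
        c * (logPlus ((i : ℝ) + 1) ^ 2 / ((i : ℝ) + 1) ^ 2) := by
    intro i _
    have hF : 0 ≤ c * (logPlus ((i : ℝ) + 1) ^ 2 / ((i : ℝ) + 1) ^ 2) := by positivity
    rcases lt_or_ge i N with hi | hi
    · rw [if_pos hi, if_neg (by omega), mul_zero, mul_zero, add_zero]
      have htriv : interactionEnergy t (b + 1 + i) k ≤ 1 / m ^ 2 :=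
        interactionEnergy_le_inv_sq hm ((hmR.trans
          (outerGap_right_le_sub hΛ hkb (by omega))).trans (le_abs_self _))
      linarith
    · rw [if_neg (by omega), if_pos hi, zero_add]
      have hiD : 2 * (16 * B * C₁ ^ 2 / c₂) * logPlus b ^ 2 ≤ ((i + 1 : ℕ) : ℝ) := by
        have h1 := Nat.le_ceil (2 * D * logPlus (b : ℝ) ^ 2)
        have h2 : (⌈2 * D * logPlus (b : ℝ) ^ 2⌉₊ : ℝ) ≤ ((i + 1 : ℕ) : ℝ) := by
          exact_mod_cast (by omega : ⌈2 * D * logPlus (b : ℝ) ^ 2⌉₊ ≤ i + 1)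
        rw [← hD]; linarith
      have hiD' : 4096 * (16 * B * C₁ ^ 2 / c₂) ^ 2 ≤ ((i + 1 : ℕ) : ℝ) := by
        have h1 := Nat.le_ceil (4096 * D ^ 2)
        have h2 : (⌈4096 * D ^ 2⌉₊ : ℝ) ≤ ((i + 1 : ℕ) : ℝ) := by
          exact_mod_cast (by omega : ⌈4096 * D ^ 2⌉₊ ≤ i + 1)
        rw [← hD]; linarith
      have h := interactionEnergy_far_right hΛ hB h50 hC₁ hord hc₂ hii hb hkb (i := i + 1)
        (by omega) hiD hiD'
      have e1 : (b + ((i + 1 : ℕ) : ℤ)) = b + 1 + i := by push_cast; ring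
      rw [e1] at h
      push_cast at h
      rw [← hc] at h
      have e2 : c * ((logPlus (b : ℝ) ^ 2 + logPlus ((i : ℝ) + 1) ^ 2) / ((i : ℝ) + 1) ^ 2) =
          c * (logPlus b ^ 2 * (1 / ((i : ℝ) + 1) ^ 2)) +
            c * (logPlus ((i : ℝ) + 1) ^ 2 / ((i : ℝ) + 1) ^ 2) := by
        field_simp
      linarith
  refine (Finset.sum_le_sum hterm).trans ?_
  rw [Finset.sum_add_distrib, Finset.sum_add_distrib, ← Finset.mul_sum, ← Finset.mul_sum,
    ← Finset.mul_sum]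
  have hT : ∑ i ∈ Finset.range n, (if i < N then 1 / m ^ 2 else (0 : ℝ)) ≤ N * (1 / m ^ 2) :=
    sum_range_indicator_const_le (by positivity) N n
  have hM : logPlus (b : ℝ) ^ 2 *
      ∑ i ∈ Finset.range n, (if N ≤ i then 1 / ((i : ℝ) + 1) ^ 2 else (0 : ℝ)) ≤ 1 := by
    have h1 := sum_range_indicator_inv_sq_le hN1 n
    have hN0 : (0 : ℝ) < N := by exact_mod_cast hN1
    calc logPlus (b : ℝ) ^ 2 * ∑ i ∈ Finset.range n, (if N ≤ i then 1 / ((i : ℝ) + 1) ^ 2 else (0 : ℝ))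
        ≤ logPlus (b : ℝ) ^ 2 * (1 / N) := mul_le_mul_of_nonneg_left h1 (by positivity)
      _ ≤ (N : ℝ) * (1 / N) := mul_le_mul_of_nonneg_right hNR (by positivity)
      _ = 1 := by field_simp
  have hF : ∑ i ∈ Finset.range n, logPlus ((i : ℝ) + 1) ^ 2 / ((i : ℝ) + 1) ^ 2 ≤ S₀ := by
    have h1 := hS₀ ((Finset.range n).image (· + 1))
    rw [Finset.sum_image fun x _ y _ h ↦ by simpa using h] at h1
    push_cast at h1
    exact h1
  have e3 : (N : ℝ) * (1 / m ^ 2) = (N : ℝ) / m ^ 2 := by ring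
  nlinarith [mul_le_mul_of_nonneg_left hM hc0, mul_le_mul_of_nonneg_left hF hc0]


/-- LEFT-SIDE SUM (positive indices `1 ≤ j < a`): for `K = [a, b]` (`2 ≤ a ≤ k`, `a ≤ b`) and any
`0 < m` below the left outer gap, `Σ_{i < n} E_{(a−1−i)k} ≤ N_b/m² + 32 C₁²/c₂²` for `n ≤ a − 1`.
[cite: RodgersTaoFMP2020, §5 p. 37 (environment bound in the proof of Prop. 13)] -/
theorem sum_interactionEnergy_left_le (hΛ : ∃ t₁ : ℝ, t₁ < t ∧ HasOnlyRealZeros (deBruijnH t₁))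
    (hB : 0 ≤ B)
    (h50 : ∀ j : ℤ, 1 ≤ j →
      |deBruijnZeroZ t j - classicalLocation (j : ℝ)| ≤ B * logPlus (classicalLocation (j : ℝ)))
    (hC₁ : 0 < C₁) (hord : ∀ y : ℝ, 1 ≤ y → logPlus (classicalLocation y) ≤ C₁ * logPlus y)
    (hc₂ : 0 < c₂)
    (hii : ∀ j k : ℤ, 1 ≤ j → j ≤ k →
      c₂ * (((k : ℝ) - j) / logPlus (classicalLocation (j : ℝ) + classicalLocation (k : ℝ))) ≤
        classicalLocation (k : ℝ) - classicalLocation (j : ℝ))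
    {k a b : ℤ} (hak : a ≤ k) (hab : a ≤ b) {m : ℝ} (hm : 0 < m)
    (hmL : m ≤ deBruijnZeroZ t a - deBruijnZeroZ t (a - 1)) {n : ℕ} (hn : (n : ℤ) ≤ a - 1) :
    ∑ i ∈ Finset.range n, interactionEnergy t (a - 1 - i) k ≤
      ((⌈2 * (16 * B * C₁ ^ 2 / c₂) * logPlus b ^ 2⌉₊ + ⌈4096 * (16 * B * C₁ ^ 2 / c₂) ^ 2⌉₊ +
          ⌈logPlus b ^ 2⌉₊ : ℕ) : ℝ) / m ^ 2 + 32 * C₁ ^ 2 / c₂ ^ 2 := by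
  set D : ℝ := 16 * B * C₁ ^ 2 / c₂ with hD
  set N : ℕ := ⌈2 * D * logPlus b ^ 2⌉₊ + ⌈4096 * D ^ 2⌉₊ + ⌈logPlus b ^ 2⌉₊ with hN
  set c : ℝ := 32 * C₁ ^ 2 / c₂ ^ 2 with hc
  have hc0 : 0 ≤ c := by rw [hc]; positivity
  have hLb : 0 < logPlus (b : ℝ) := logPlus_pos _
  have hN1 : 1 ≤ N := by
    have : 1 ≤ ⌈logPlus (b : ℝ) ^ 2⌉₊ := Nat.one_le_ceil_iff.2 (by positivity)
    omega
  have hNR : logPlus (b : ℝ) ^ 2 ≤ N := by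
    rw [hN]; push_cast
    have h1 := Nat.le_ceil (logPlus (b : ℝ) ^ 2)
    have h2 : (0 : ℝ) ≤ ⌈2 * D * logPlus (b : ℝ) ^ 2⌉₊ := by positivity
    have h3 : (0 : ℝ) ≤ ⌈4096 * D ^ 2⌉₊ := by positivity
    linarith
  have hterm : ∀ i ∈ Finset.range n, interactionEnergy t (a - 1 - i) k ≤
      (if i < N then 1 / m ^ 2 else 0) +
        c * (logPlus b ^ 2 * (if N ≤ i then 1 / ((i : ℝ) + 1) ^ 2 else 0)) := by
    intro i hi
    rw [Finset.mem_range] at hi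
    rcases lt_or_ge i N with hiN | hiN
    · rw [if_pos hiN, if_neg (by omega), mul_zero, mul_zero, add_zero]
      exact interactionEnergy_le_inv_sq hm ((hmL.trans
        (outerGap_left_le_sub hΛ hak (j := a - 1 - i) (by omega))).trans
          (by rw [abs_sub_comm]; exact le_abs_self _))
    · rw [if_neg (by omega), if_pos hiN, zero_add]
      have hiD : 2 * (16 * B * C₁ ^ 2 / c₂) * logPlus b ^ 2 ≤ ((i + 1 : ℕ) : ℝ) := by
        have h1 := Nat.le_ceil (2 * D * logPlus (b : ℝ) ^ 2)
        have h2 : (⌈2 * D * logPlus (b : ℝ) ^ 2⌉₊ : ℝ) ≤ ((i + 1 : ℕ) : ℝ) := by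
          exact_mod_cast (by omega : ⌈2 * D * logPlus (b : ℝ) ^ 2⌉₊ ≤ i + 1)
        rw [← hD]; linarith
      have h := interactionEnergy_far_left hΛ hB h50 hC₁ hord hc₂ hii hak hab (i := i + 1)
        (by omega) (by push_cast; omega) hiD
      have e1 : (a - ((i + 1 : ℕ) : ℤ)) = a - 1 - i := by push_cast; ring
      rw [e1] at h
      push_cast at h
      rw [← hc] at h
      have e2 : c * (logPlus (b : ℝ) ^ 2 / ((i : ℝ) + 1) ^ 2) =
          c * (logPlus b ^ 2 * (1 / ((i : ℝ) + 1) ^ 2)) := by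
        field_simp
      linarith
  refine (Finset.sum_le_sum hterm).trans ?_
  rw [Finset.sum_add_distrib, ← Finset.mul_sum, ← Finset.mul_sum]
  have hT : ∑ i ∈ Finset.range n, (if i < N then 1 / m ^ 2 else (0 : ℝ)) ≤ N * (1 / m ^ 2) :=
    sum_range_indicator_const_le (by positivity) N n
  have hM : logPlus (b : ℝ) ^ 2 *
      ∑ i ∈ Finset.range n, (if N ≤ i then 1 / ((i : ℝ) + 1) ^ 2 else (0 : ℝ)) ≤ 1 := by
    have h1 := sum_range_indicator_inv_sq_le hN1 n
    have hN0 : (0 : ℝ) < N := by exact_mod_cast hN1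
    calc logPlus (b : ℝ) ^ 2 * ∑ i ∈ Finset.range n, (if N ≤ i then 1 / ((i : ℝ) + 1) ^ 2 else (0 : ℝ))
        ≤ logPlus (b : ℝ) ^ 2 * (1 / N) := mul_le_mul_of_nonneg_left h1 (by positivity)
      _ ≤ (N : ℝ) * (1 / N) := mul_le_mul_of_nonneg_right hNR (by positivity)
      _ = 1 := by field_simp
  have e3 : (N : ℝ) * (1 / m ^ 2) = (N : ℝ) / m ^ 2 := by ring
  nlinarith [mul_le_mul_of_nonneg_left hM hc0]

/-- NEGATIVE-SIDE SUM: for `K = [a, b]` (`2 ≤ a ≤ k`) and any `0 < m` below the left outer gap,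
`Σ_{i < n} E_{(−(i+1))k} ≤ ⌈1296 B⁴⌉/m² + (4/c₁²) S₀`.
[cite: RodgersTaoFMP2020, §5 p. 37 (environment bound in the proof of Prop. 13)] -/
theorem sum_interactionEnergy_neg_le (hΛ : ∃ t₁ : ℝ, t₁ < t ∧ HasOnlyRealZeros (deBruijnH t₁))
    (hB : 0 ≤ B)
    (h50 : ∀ j : ℤ, 1 ≤ j →
      |deBruijnZeroZ t j - classicalLocation (j : ℝ)| ≤ B * logPlus (classicalLocation (j : ℝ)))
    (hc₁ : 0 < c₁) (hordl : ∀ y : ℝ, 1 ≤ y → c₁ * (y / logPlus y) ≤ classicalLocation y)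
    {S₀ : ℝ} (hS₀ : ∀ T : Finset ℕ, ∑ n ∈ T, logPlus n ^ 2 / (n : ℝ) ^ 2 ≤ S₀)
    {k a : ℤ} (ha : 2 ≤ a) (hak : a ≤ k) {m : ℝ} (hm : 0 < m)
    (hmL : m ≤ deBruijnZeroZ t a - deBruijnZeroZ t (a - 1)) (n : ℕ) :
    ∑ i ∈ Finset.range n, interactionEnergy t (-((i : ℤ) + 1)) k ≤
      (⌈1296 * B ^ 4⌉₊ : ℝ) / m ^ 2 + 4 / c₁ ^ 2 * S₀ := by
  set N : ℕ := ⌈1296 * B ^ 4⌉₊ with hN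
  set c : ℝ := 4 / c₁ ^ 2 with hc
  have hc0 : 0 ≤ c := by rw [hc]; positivity
  have hterm : ∀ i ∈ Finset.range n, interactionEnergy t (-((i : ℤ) + 1)) k ≤
      (if i < N then 1 / m ^ 2 else 0) +
        c * (logPlus ((i : ℝ) + 1) ^ 2 / ((i : ℝ) + 1) ^ 2) := by
    intro i _
    have hF : 0 ≤ c * (logPlus ((i : ℝ) + 1) ^ 2 / ((i : ℝ) + 1) ^ 2) := by positivity
    rcases lt_or_ge i N with hiN | hiN
    · rw [if_pos hiN]
      have htriv : interactionEnergy t (-((i : ℤ) + 1)) k ≤ 1 / m ^ 2 :=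
        interactionEnergy_le_inv_sq hm ((hmL.trans
          (outerGap_left_le_sub hΛ hak (j := -((i : ℤ) + 1)) (by omega))).trans
            (by rw [abs_sub_comm]; exact le_abs_self _))
      linarith
    · rw [if_neg (by omega), zero_add]
      have hnB : 1296 * B ^ 4 ≤ ((i + 1 : ℕ) : ℝ) := by
        have h1 := Nat.le_ceil (1296 * B ^ 4)
        have h2 : (⌈1296 * B ^ 4⌉₊ : ℝ) ≤ ((i + 1 : ℕ) : ℝ) := by
          exact_mod_cast (by omega : ⌈1296 * B ^ 4⌉₊ ≤ i + 1)
        linarith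
      have h := interactionEnergy_far_neg hΛ hB h50 hc₁ hordl (k := k) (by omega) (n := i + 1)
        (by omega) hnB
      push_cast at h
      rw [← hc] at h
      exact h
  refine (Finset.sum_le_sum hterm).trans ?_
  rw [Finset.sum_add_distrib, ← Finset.mul_sum]
  have hT : ∑ i ∈ Finset.range n, (if i < N then 1 / m ^ 2 else (0 : ℝ)) ≤ N * (1 / m ^ 2) :=
    sum_range_indicator_const_le (by positivity) N n
  have hF : ∑ i ∈ Finset.range n, logPlus ((i : ℝ) + 1) ^ 2 / ((i : ℝ) + 1) ^ 2 ≤ S₀ := by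
    have h1 := hS₀ ((Finset.range n).image (· + 1))
    rw [Finset.sum_image fun x _ y _ h ↦ by simpa using h] at h1
    push_cast at h1
    exact h1
  have e3 : (N : ℝ) * (1 / m ^ 2) = (N : ℝ) / m ^ 2 := by ring
  nlinarith [mul_le_mul_of_nonneg_left hF hc0]

/-- **The environment energy of an interval is controlled by its outer gaps** (RH-free content of
the display «`Σ_{j ∉ K} E_{kj} ≪ 1 + (log²₊ ξ_k) min_{j ∉ K} |x_k − x_j|⁻²`», FMP p. 37, in the form
used there three lines later with `min_{j ∉ K}|x_k − x_j| ≥ min(|x_{k₋} − x_{k₋−1}|, |x_{k₊} − x_{k₊+1}|)`):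
for `K = [a, b]_{ℤ*}`, `2 ≤ a ≤ k ≤ b`, and any `0 < m ≤ min(x_a − x_{a−1}, x_{b+1} − x_b)`, every
finite sum of `E_{jk}` over `j ∈ ℤ* ∖ K` is at most `(2 N_b + ⌈1296 B⁴⌉)/m² + C'` with
`N_b = ⌈2D log₊² b⌉ + ⌈4096 D²⌉ + ⌈log₊² b⌉`, `D = 16 B C₁²/c₂`,
`C' = (32 C₁²/c₂²)(2 + S₀) + (4/c₁²) S₀`. Derived from (50) and Lemma 8 only (the source uses (52)).
[cite: RodgersTaoFMP2020, §5 p. 37 (environment bound in the proof of Prop. 13)] -/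
theorem sum_interactionEnergy_compl_le (hΛ : ∃ t₁ : ℝ, t₁ < t ∧ HasOnlyRealZeros (deBruijnH t₁))
    (hB : 0 ≤ B)
    (h50 : ∀ j : ℤ, 1 ≤ j →
      |deBruijnZeroZ t j - classicalLocation (j : ℝ)| ≤ B * logPlus (classicalLocation (j : ℝ)))
    (hc₁ : 0 < c₁) (hordl : ∀ y : ℝ, 1 ≤ y → c₁ * (y / logPlus y) ≤ classicalLocation y)
    (hC₁ : 0 < C₁) (hord : ∀ y : ℝ, 1 ≤ y → logPlus (classicalLocation y) ≤ C₁ * logPlus y)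
    (hc₂ : 0 < c₂)
    (hii : ∀ j k : ℤ, 1 ≤ j → j ≤ k →
      c₂ * (((k : ℝ) - j) / logPlus (classicalLocation (j : ℝ) + classicalLocation (k : ℝ))) ≤
        classicalLocation (k : ℝ) - classicalLocation (j : ℝ))
    {S₀ : ℝ} (hS₀ : ∀ T : Finset ℕ, ∑ n ∈ T, logPlus n ^ 2 / (n : ℝ) ^ 2 ≤ S₀)
    {k a b : ℤ} (ha : 2 ≤ a) (hak : a ≤ k) (hkb : k ≤ b) {m : ℝ} (hm : 0 < m)
    (hmL : m ≤ deBruijnZeroZ t a - deBruijnZeroZ t (a - 1))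
    (hmR : m ≤ deBruijnZeroZ t (b + 1) - deBruijnZeroZ t b)
    (S : Finset ℤ) (hS : ∀ j ∈ S, j ≠ 0 ∧ (j < a ∨ b < j)) :
    ∑ j ∈ S, interactionEnergy t j k ≤
      (2 * ((⌈2 * (16 * B * C₁ ^ 2 / c₂) * logPlus b ^ 2⌉₊ + ⌈4096 * (16 * B * C₁ ^ 2 / c₂) ^ 2⌉₊ +
          ⌈logPlus b ^ 2⌉₊ : ℕ) : ℝ) + (⌈1296 * B ^ 4⌉₊ : ℝ)) / m ^ 2 +
        (32 * C₁ ^ 2 / c₂ ^ 2 * (2 + S₀) + 4 / c₁ ^ 2 * S₀) := by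
  classical
  have hab : a ≤ b := hak.trans hkb
  have hb : 1 ≤ b := by omega
  -- the three index families
  set n : ℕ := S.sup Int.natAbs + 1 with hn
  have hnS : ∀ j ∈ S, j.natAbs < n := fun j hj ↦ by
    have := Finset.le_sup (f := Int.natAbs) hj; omega
  set A₁ : Finset ℤ := (Finset.range n).image (fun i : ℕ ↦ b + 1 + (i : ℤ)) with hA₁
  set A₂ : Finset ℤ := (Finset.range (a - 1).toNat).image (fun i : ℕ ↦ a - 1 - (i : ℤ)) with hA₂
  set A₃ : Finset ℤ := (Finset.range n).image (fun i : ℕ ↦ -((i : ℤ) + 1)) with hA₃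
  have hsub : S ⊆ A₁ ∪ A₂ ∪ A₃ := by
    intro j hj
    obtain ⟨hj0, hj'⟩ := hS j hj
    have hjn := hnS j hj
    rw [Finset.mem_union, Finset.mem_union]
    rcases hj' with hja | hbj
    · rcases lt_or_gt_of_ne hj0 with hneg | hpos
      · right
        rw [hA₃, Finset.mem_image]
        refine ⟨(-j - 1).toNat, Finset.mem_range.2 ?_, ?_⟩
        · have : ((-j - 1).toNat : ℤ) = -j - 1 := Int.toNat_of_nonneg (by omega)
          have h2 : (j.natAbs : ℤ) = -j := by omega
          omega
        · have : ((-j - 1).toNat : ℤ) = -j - 1 := Int.toNat_of_nonneg (by omega)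
          omega
      · left; right
        rw [hA₂, Finset.mem_image]
        refine ⟨(a - 1 - j).toNat, Finset.mem_range.2 ?_, ?_⟩
        · have h1 : ((a - 1 - j).toNat : ℤ) = a - 1 - j := Int.toNat_of_nonneg (by omega)
          have h2 : (((a - 1).toNat : ℕ) : ℤ) = a - 1 := Int.toNat_of_nonneg (by omega)
          omega
        · have : ((a - 1 - j).toNat : ℤ) = a - 1 - j := Int.toNat_of_nonneg (by omega)
          omega
    · left; left
      rw [hA₁, Finset.mem_image]
      refine ⟨(j - b - 1).toNat, Finset.mem_range.2 ?_, ?_⟩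
      · have : ((j - b - 1).toNat : ℤ) = j - b - 1 := Int.toNat_of_nonneg (by omega)
        have h2 : (j.natAbs : ℤ) = j := by omega
        omega
      · have : ((j - b - 1).toNat : ℤ) = j - b - 1 := Int.toNat_of_nonneg (by omega)
        omega
  have hE0 : ∀ j, 0 ≤ interactionEnergy t j k := fun j ↦ interactionEnergy_nonneg t j k
  have h1 : ∑ j ∈ S, interactionEnergy t j k ≤ ∑ j ∈ A₁ ∪ A₂ ∪ A₃, interactionEnergy t j k :=
    Finset.sum_le_sum_of_subset_of_nonneg hsub fun j _ _ ↦ hE0 j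
  have h2 : ∑ j ∈ A₁ ∪ A₂ ∪ A₃, interactionEnergy t j k ≤
      ∑ j ∈ A₁, interactionEnergy t j k + ∑ j ∈ A₂, interactionEnergy t j k +
        ∑ j ∈ A₃, interactionEnergy t j k :=
    (sum_union_le_add hE0 _ _).trans (by linarith [sum_union_le_add hE0 A₁ A₂])
  have hA₁sum : ∑ j ∈ A₁, interactionEnergy t j k =
      ∑ i ∈ Finset.range n, interactionEnergy t (b + 1 + i) k := by
    rw [hA₁, Finset.sum_image fun x _ y _ h ↦ by simpa using h]
  have hA₂sum : ∑ j ∈ A₂, interactionEnergy t j k =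
      ∑ i ∈ Finset.range (a - 1).toNat, interactionEnergy t (a - 1 - i) k := by
    rw [hA₂, Finset.sum_image fun x _ y _ h ↦ by simpa using h]
  have hA₃sum : ∑ j ∈ A₃, interactionEnergy t j k =
      ∑ i ∈ Finset.range n, interactionEnergy t (-((i : ℤ) + 1)) k := by
    rw [hA₃, Finset.sum_image fun x _ y _ h ↦ by simpa using h]
  have hR := sum_interactionEnergy_right_le hΛ hB h50 hC₁ hord hc₂ hii hS₀ hb hkb hm hmR n
  have hL := sum_interactionEnergy_left_le hΛ hB h50 hC₁ hord hc₂ hii hak hab hm hmL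
    (n := (a - 1).toNat) (by rw [Int.toNat_of_nonneg (by omega)])
  have hNg := sum_interactionEnergy_neg_le hΛ hB h50 hc₁ hordl hS₀ ha hak hm hmL n
  rw [hA₁sum, hA₂sum, hA₃sum] at h2
  have e : (2 * ((⌈2 * (16 * B * C₁ ^ 2 / c₂) * logPlus b ^ 2⌉₊ +
      ⌈4096 * (16 * B * C₁ ^ 2 / c₂) ^ 2⌉₊ + ⌈logPlus b ^ 2⌉₊ : ℕ) : ℝ) + (⌈1296 * B ^ 4⌉₊ : ℝ)) / m ^ 2 +
        (32 * C₁ ^ 2 / c₂ ^ 2 * (2 + S₀) + 4 / c₁ ^ 2 * S₀) =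
      (((⌈2 * (16 * B * C₁ ^ 2 / c₂) * logPlus b ^ 2⌉₊ + ⌈4096 * (16 * B * C₁ ^ 2 / c₂) ^ 2⌉₊ +
          ⌈logPlus b ^ 2⌉₊ : ℕ) : ℝ) / m ^ 2 + 32 * C₁ ^ 2 / c₂ ^ 2 * (1 + S₀)) +
      ((((⌈2 * (16 * B * C₁ ^ 2 / c₂) * logPlus b ^ 2⌉₊ + ⌈4096 * (16 * B * C₁ ^ 2 / c₂) ^ 2⌉₊ +
          ⌈logPlus b ^ 2⌉₊ : ℕ) : ℝ) / m ^ 2 + 32 * C₁ ^ 2 / c₂ ^ 2)) +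
      ((⌈1296 * B ^ 4⌉₊ : ℝ) / m ^ 2 + 4 / c₁ ^ 2 * S₀) := by ring
  rw [e]
  linarith


/-- `Σ'`-form of `sum_interactionEnergy_compl_le`: the cross energy `Σ_{j ∈ ℤ* ∖ [a,b]} E_{jk}` of
one zero `x_k`, `k ∈ [a, b]`, against the environment is at most `Φ_b/m² + C'` (notation of that
lemma). [cite: RodgersTaoFMP2020, §5 p. 37 (environment bound in the proof of Prop. 13)] -/
theorem crossEnergy_interval_le (hΛ : ∃ t₁ : ℝ, t₁ < t ∧ HasOnlyRealZeros (deBruijnH t₁))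
    (hB : 0 ≤ B)
    (h50 : ∀ j : ℤ, 1 ≤ j →
      |deBruijnZeroZ t j - classicalLocation (j : ℝ)| ≤ B * logPlus (classicalLocation (j : ℝ)))
    (hc₁ : 0 < c₁) (hordl : ∀ y : ℝ, 1 ≤ y → c₁ * (y / logPlus y) ≤ classicalLocation y)
    (hC₁ : 0 < C₁) (hord : ∀ y : ℝ, 1 ≤ y → logPlus (classicalLocation y) ≤ C₁ * logPlus y)
    (hc₂ : 0 < c₂)
    (hii : ∀ j k : ℤ, 1 ≤ j → j ≤ k →
      c₂ * (((k : ℝ) - j) / logPlus (classicalLocation (j : ℝ) + classicalLocation (k : ℝ))) ≤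
        classicalLocation (k : ℝ) - classicalLocation (j : ℝ))
    {S₀ : ℝ} (hS₀ : ∀ T : Finset ℕ, ∑ n ∈ T, logPlus n ^ 2 / (n : ℝ) ^ 2 ≤ S₀)
    {k a b : ℤ} (ha : 2 ≤ a) (hak : a ≤ k) (hkb : k ≤ b) {m : ℝ} (hm : 0 < m)
    (hmL : m ≤ deBruijnZeroZ t a - deBruijnZeroZ t (a - 1))
    (hmR : m ≤ deBruijnZeroZ t (b + 1) - deBruijnZeroZ t b) :
    ∑' j : zstarCompl (zstarIcc a b), interactionEnergy t j k ≤
      (2 * ((⌈2 * (16 * B * C₁ ^ 2 / c₂) * logPlus b ^ 2⌉₊ + ⌈4096 * (16 * B * C₁ ^ 2 / c₂) ^ 2⌉₊ +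
          ⌈logPlus b ^ 2⌉₊ : ℕ) : ℝ) + (⌈1296 * B ^ 4⌉₊ : ℝ)) / m ^ 2 +
        (32 * C₁ ^ 2 / c₂ ^ 2 * (2 + S₀) + 4 / c₁ ^ 2 * S₀) := by
  refine Real.tsum_le_of_sum_le (fun j ↦ interactionEnergy_nonneg _ _ _) fun u ↦ ?_
  have h := sum_interactionEnergy_compl_le hΛ hB h50 hc₁ hordl hC₁ hord hc₂ hii hS₀ ha hak hkb hm
    hmL hmR (u.map (Function.Embedding.subtype _)) fun j hj ↦ by
      rw [Finset.mem_map] at hj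
      obtain ⟨x, -, rfl⟩ := hj
      have hx := x.2
      simp only [mem_zstarCompl, mem_zstarIcc, Function.Embedding.coe_subtype] at hx ⊢
      omega
  rwa [Finset.sum_map] at h

end EnvEnergy

/-! ## §B. One enlargement step (display (60), FMP p. 37)

«… if `δ(K) ≤ c|K|⁻³` for a sufficiently small `c > 0`, then there exists `k ∈ K` such that
`min_{j ∉ K}|x_k − x_j| ≪ |K|³ δ(K) log₊ ξ_k` …, which implies `δ(K') ≪ |K|³ log(k₊) δ(K)` … where
`K'` is either `[k₋ − 1, k₊]_{ℤ*}` or `[k₋, k₊ + 1]_{ℤ*}`; we call `K'` an enlargement of `K`.»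
Here with Lemma 14 in house form (constant `c_K`) and §A's environment bound abstracted as
`Σ_{j ∉ K} E_{jk} ≤ Φ(k₊)/m² + C'`: the smaller outer gap `m` of `K = [a, b]` satisfies
`m ≤ (2Φ(b)/c_K + 1) δ(K)` as soon as `δ(K)² ≤ c_K/(2(C' + 1))` (no `|K|`-dependence is needed). -/

section Enlargement

variable {t : ℝ}

/-- `[a, b]_{ℤ*} = [a, b]` for `a ≥ 1`, with `|[a, b]| = b − a + 1`.
[cite: RodgersTaoFMP2020, §1.2 p. 7] -/
theorem zstarIcc_eq_Icc {a b : ℤ} (ha : 1 ≤ a) : zstarIcc a b = Finset.Icc a b := by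
  ext j
  simp only [mem_zstarIcc, Finset.mem_Icc]
  constructor
  · rintro ⟨-, h1, h2⟩; exact ⟨h1, h2⟩
  · rintro ⟨h1, h2⟩; exact ⟨by omega, h1, h2⟩

/-- `|[a, b]_{ℤ*}| = b − a + 1` for `1 ≤ a ≤ b`. [cite: RodgersTaoFMP2020, §1.2 p. 7] -/
theorem card_zstarIcc {a b : ℤ} (ha : 1 ≤ a) (hab : a ≤ b) :
    ((zstarIcc a b).card : ℝ) = (b : ℝ) - a + 1 := by
  rw [zstarIcc_eq_Icc ha, Int.card_Icc]
  have : ((b + 1 - a).toNat : ℤ) = b + 1 - a := Int.toNat_of_nonneg (by omega)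
  have h2 : (((b + 1 - a).toNat : ℕ) : ℝ) = ((b + 1 - a : ℤ) : ℝ) := by exact_mod_cast this
  rw [h2]; push_cast; ring

/-- **One enlargement step.** At a time `t > Λ` let Lemma 14 hold with constant `c_K > 0` and let
the environment energies of intervals be bounded by `Φ(b)/m² + C'` (§A). If `K = [a, b]`,
`2 ≤ a < b`, has diameter `δ(K) = x_b − x_a` with `δ(K)² ≤ c_K/(2(C'+1))`, then the smaller of the
two outer gaps `x_a − x_{a−1}`, `x_{b+1} − x_b` is at most `(2Φ(b)/c_K + 1)·δ(K)`; i.e. one of the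
two enlargements `K'` of `K` has `δ(K') ≤ (2Φ(b)/c_K + 2) δ(K)`.
[cite: RodgersTaoFMP2020, §5 p. 37, display (60)] -/
theorem outerGap_le_of_diam_small (hΛ : ∃ t₁ : ℝ, t₁ < t ∧ HasOnlyRealZeros (deBruijnH t₁))
    {cK : ℝ} (hcK : 0 < cK)
    (hL14 : ∀ K : Finset ℤ, (0 : ℤ) ∉ K → 2 ≤ K.card →
      cK * (K.card : ℝ) ^ 3 / (1 + ∑ k ∈ K, ∑' j : zstarCompl K, interactionEnergy t j k) ≤
        ∑ p ∈ K.offDiag, (deBruijnZeroZ t p.1 - deBruijnZeroZ t p.2) ^ 2)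
    {Φ : ℤ → ℝ} {C' : ℝ} (hΦ : ∀ b, 0 ≤ Φ b) (hC' : 0 ≤ C')
    (hA : ∀ a b k : ℤ, 2 ≤ a → a ≤ k → k ≤ b → ∀ m : ℝ, 0 < m →
      m ≤ deBruijnZeroZ t a - deBruijnZeroZ t (a - 1) →
      m ≤ deBruijnZeroZ t (b + 1) - deBruijnZeroZ t b →
      ∑' j : zstarCompl (zstarIcc a b), interactionEnergy t j k ≤ Φ b / m ^ 2 + C')
    {a b : ℤ} (ha : 2 ≤ a) (hab : a < b)
    (hδ : (deBruijnZeroZ t b - deBruijnZeroZ t a) ^ 2 ≤ cK / (2 * (C' + 1))) :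
    min (deBruijnZeroZ t a - deBruijnZeroZ t (a - 1)) (deBruijnZeroZ t (b + 1) - deBruijnZeroZ t b) ≤
      (2 * Φ b / cK + 1) * (deBruijnZeroZ t b - deBruijnZeroZ t a) := by
  classical
  have hsm := strictMono_deBruijnZeroZ hΛ
  set δ : ℝ := deBruijnZeroZ t b - deBruijnZeroZ t a with hδdef
  set m : ℝ := min (deBruijnZeroZ t a - deBruijnZeroZ t (a - 1))
    (deBruijnZeroZ t (b + 1) - deBruijnZeroZ t b) with hmdef
  have hδ0 : 0 < δ := sub_pos.2 (hsm hab)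
  have hm0 : 0 < m := lt_min (sub_pos.2 (hsm (by omega))) (sub_pos.2 (hsm (by omega)))
  have hmL : m ≤ deBruijnZeroZ t a - deBruijnZeroZ t (a - 1) := min_le_left _ _
  have hmR : m ≤ deBruijnZeroZ t (b + 1) - deBruijnZeroZ t b := min_le_right _ _
  set K : Finset ℤ := zstarIcc a b with hK
  set N : ℝ := (K.card : ℝ) with hN
  have hNeq : N = (b : ℝ) - a + 1 := card_zstarIcc (by omega) hab.le
  have hN2 : 2 ≤ N := by
    rw [hNeq]; have : (a : ℝ) + 1 ≤ b := by exact_mod_cast hab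
    linarith
  have hcard2 : 2 ≤ K.card := by
    have h := hN2; rw [hN] at h; exact_mod_cast h
  have hKne : K.Nonempty := Finset.card_pos.1 (by omega)
  set CE : ℝ := ∑ k ∈ K, ∑' j : zstarCompl K, interactionEnergy t j k with hCE
  have hCE0 : 0 ≤ CE := Finset.sum_nonneg fun k _ ↦ tsum_nonneg fun j ↦ interactionEnergy_nonneg _ _ _
  -- Lemma 14 and the trivial upper bound by the diameter
  have h14 := hL14 K (zero_notMem_zstarIcc a b) hcard2
  have hup : ∑ p ∈ K.offDiag, (deBruijnZeroZ t p.1 - deBruijnZeroZ t p.2) ^ 2 ≤ N ^ 2 * δ ^ 2 := by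
    have h1 : ∀ p ∈ K.offDiag, (deBruijnZeroZ t p.1 - deBruijnZeroZ t p.2) ^ 2 ≤ δ ^ 2 := by
      intro p hp
      rw [Finset.mem_offDiag, hK, mem_zstarIcc, mem_zstarIcc] at hp
      obtain ⟨⟨-, h1a, h1b⟩, ⟨-, h2a, h2b⟩, -⟩ := hp
      have e1 := hsm.monotone h1a; have e2 := hsm.monotone h1b
      have e3 := hsm.monotone h2a; have e4 := hsm.monotone h2b
      apply sq_le_sq'
      · rw [hδdef]; linarith
      · rw [hδdef]; linarith
    refine (Finset.sum_le_card_nsmul _ _ _ h1).trans ?_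
    rw [nsmul_eq_mul, Finset.offDiag_card]
    have : ((K.card * K.card - K.card : ℕ) : ℝ) ≤ N ^ 2 := by
      have h2 : ((K.card * K.card - K.card : ℕ) : ℝ) ≤ ((K.card * K.card : ℕ) : ℝ) := by
        exact_mod_cast Nat.sub_le _ _
      rw [hN]; push_cast at h2
      exact h2.trans (le_of_eq (sq (K.card : ℝ)).symm)
    exact mul_le_mul_of_nonneg_right this (by positivity)
  have hstar : cK * N ≤ δ ^ 2 * (1 + CE) := by
    have h1 : cK * N ^ 3 / (1 + CE) ≤ N ^ 2 * δ ^ 2 := h14.trans hup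
    rw [div_le_iff₀ (by positivity)] at h1
    have hN0 : 0 < N := by linarith
    have : (cK * N) * N ^ 2 ≤ (δ ^ 2 * (1 + CE)) * N ^ 2 :=
      calc (cK * N) * N ^ 2 = cK * N ^ 3 := by ring
        _ ≤ N ^ 2 * δ ^ 2 * (1 + CE) := h1
        _ = (δ ^ 2 * (1 + CE)) * N ^ 2 := by ring
    exact le_of_mul_le_mul_right this (pow_pos hN0 2)
  -- pigeonhole and §A
  obtain ⟨k, hkK, hk⟩ : ∃ k ∈ K, CE / N ≤ ∑' j : zstarCompl K, interactionEnergy t j k := by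
    refine Finset.exists_le_of_sum_le hKne (le_of_eq ?_)
    rw [Finset.sum_const, nsmul_eq_mul, ← hN, hCE]
    have hN0 : N ≠ 0 := by linarith
    field_simp
  have hkK' := hkK
  rw [hK, mem_zstarIcc] at hkK'
  have hAk := hA a b k ha hkK'.2.1 hkK'.2.2 m hm0 hmL hmR
  have hCEle : CE ≤ N * (Φ b / m ^ 2 + C') := by
    have hN0 : 0 < N := by linarith
    have := hk.trans hAk
    rwa [div_le_iff₀' hN0] at this
  -- combine
  have hN1 : 1 ≤ N := by linarith
  have h2 : cK * N ≤ δ ^ 2 * (N * (1 + C' + Φ b / m ^ 2)) := by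
    have e1 : 1 + CE ≤ N * (1 + C' + Φ b / m ^ 2) := by
      have e2 : N * (1 + C' + Φ b / m ^ 2) = N + N * (Φ b / m ^ 2 + C') := by ring
      rw [e2]; linarith
    exact hstar.trans (mul_le_mul_of_nonneg_left e1 (by positivity))
  have h3 : cK ≤ δ ^ 2 * (1 + C') + δ ^ 2 * (Φ b / m ^ 2) := by
    have hN0 : 0 < N := by linarith
    have : cK * N ≤ (δ ^ 2 * (1 + C') + δ ^ 2 * (Φ b / m ^ 2)) * N :=
      h2.trans (le_of_eq (by ring))
    exact le_of_mul_le_mul_right this hN0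
  have h4 : δ ^ 2 * (1 + C') ≤ cK / 2 :=
    calc δ ^ 2 * (1 + C') = δ ^ 2 * (C' + 1) := by ring
      _ ≤ cK / (2 * (C' + 1)) * (C' + 1) := mul_le_mul_of_nonneg_right hδ (by positivity)
      _ = cK / 2 := by rw [div_mul_eq_mul_div]; exact mul_div_mul_right cK 2 (by positivity)
  have h5 : cK / 2 ≤ δ ^ 2 * (Φ b / m ^ 2) := by linarith
  set X : ℝ := 2 * Φ b / cK with hXdef
  have hX : 0 ≤ X := by have := hΦ b; positivity
  have h6 : m ^ 2 ≤ X * δ ^ 2 := by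
    have e1 : cK / 2 * m ^ 2 ≤ δ ^ 2 * Φ b := by
      have := mul_le_mul_of_nonneg_right h5 (sq_nonneg m)
      rwa [mul_assoc, div_mul_cancel₀ _ (by positivity)] at this
    have e2 := (le_div_iff₀' (show (0 : ℝ) < cK / 2 by positivity)).2 e1
    refine e2.trans (le_of_eq ?_)
    rw [hXdef]; field_simp
  have h7 : m ^ 2 ≤ ((X + 1) * δ) ^ 2 := by
    have hX1 : X ≤ (X + 1) ^ 2 := by nlinarith [sq_nonneg X]
    calc m ^ 2 ≤ X * δ ^ 2 := h6
      _ ≤ (X + 1) ^ 2 * δ ^ 2 := mul_le_mul_of_nonneg_right hX1 (sq_nonneg _)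
      _ = ((X + 1) * δ) ^ 2 := by ring
  exact (pow_le_pow_iff_left₀ hm0.le (by positivity) two_ne_zero).1 h7

end Enlargement


/-! ## §C. Iterating the enlargement (FMP pp. 37–38: «By iterating (60) at most `log j` times
starting from the interval `K₁ := [j, j+1]_{ℤ*}`, we can find a sequence `K₁ ⊂ K₂ ⊂ … ⊂ K_r` …»)

Formalised as an induction on the number `n` of remaining enlargement steps inside a window
`[lo, hi]`: if every interval of the terminal width has diameter `≥ τ`, then an interval `[a, b]`
that can still be enlarged `n` times has diameter `≥ (1 + M₁)⁻ⁿ min(√θ₀, τ)`, where `θ₀` is the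
smallness threshold and `M₁` the growth factor of one step (§B). -/

section Iteration

variable {t : ℝ}

/-- **The enlargement iteration.** [cite: RodgersTaoFMP2020, §5 pp. 37–38 (properties (i), (ii) of the chain `K₁ ⊂ ⋯ ⊂ K_r`)] -/
theorem min_le_growth_pow_mul_diam (hΛ : ∃ t₁ : ℝ, t₁ < t ∧ HasOnlyRealZeros (deBruijnH t₁))
    {θ₀ M₁ τ : ℝ} (hM₁ : 0 ≤ M₁) {lo hi : ℤ}
    (hstep : ∀ a b : ℤ, lo ≤ a → a < b → b ≤ hi →
      (deBruijnZeroZ t b - deBruijnZeroZ t a) ^ 2 ≤ θ₀ →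
      min (deBruijnZeroZ t a - deBruijnZeroZ t (a - 1))
          (deBruijnZeroZ t (b + 1) - deBruijnZeroZ t b) ≤
        M₁ * (deBruijnZeroZ t b - deBruijnZeroZ t a))
    {w : ℤ} (hterm : ∀ a' b' : ℤ, lo ≤ a' → b' ≤ hi → b' - a' = w →
      τ ≤ deBruijnZeroZ t b' - deBruijnZeroZ t a') :
    ∀ n : ℕ, ∀ a b : ℤ, lo ≤ a - n → b + n ≤ hi → a < b → b - a + n = w →
      min (Real.sqrt θ₀) τ ≤ (1 + M₁) ^ n * (deBruijnZeroZ t b - deBruijnZeroZ t a) := by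
  have hsm := strictMono_deBruijnZeroZ hΛ
  intro n
  induction n with
  | zero =>
      intro a b hlo hhi hab hw
      simp only [Nat.cast_zero, sub_zero, add_zero, pow_zero, one_mul] at hlo hhi hw ⊢
      exact (min_le_right _ _).trans (hterm a b hlo hhi hw)
  | succ n ih =>
      intro a b hlo hhi hab hw
      push_cast at hlo hhi hw
      set δ : ℝ := deBruijnZeroZ t b - deBruijnZeroZ t a with hδ
      have hδ0 : 0 < δ := sub_pos.2 (hsm hab)
      have hpow1 : 1 ≤ (1 + M₁) ^ (n + 1) := one_le_pow₀ (by linarith)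
      rcases lt_or_ge (Real.sqrt θ₀) δ with hbig | hsmall
      · -- the chain stops: the diameter already exceeds the threshold
        calc min (Real.sqrt θ₀) τ ≤ Real.sqrt θ₀ := min_le_left _ _
          _ ≤ δ := hbig.le
          _ ≤ (1 + M₁) ^ (n + 1) * δ := le_mul_of_one_le_left hδ0.le hpow1
      · -- enlarge on the side of the smaller outer gap
        have hθ : δ ^ 2 ≤ θ₀ := by
          rcases le_or_gt 0 θ₀ with h0 | h0
          · calc δ ^ 2 ≤ Real.sqrt θ₀ ^ 2 := pow_le_pow_left₀ hδ0.le hsmall 2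
              _ = θ₀ := Real.sq_sqrt h0
          · exact absurd (hsmall.trans_lt' (by rw [Real.sqrt_eq_zero'.2 h0.le]; exact hδ0)) (lt_irrefl _)
        have hst := hstep a b (by omega) hab (by omega) hθ
        rcases le_total (deBruijnZeroZ t a - deBruijnZeroZ t (a - 1))
            (deBruijnZeroZ t (b + 1) - deBruijnZeroZ t b) with hL | hR
        · rw [min_eq_left hL] at hst
          have h := ih (a - 1) b (by omega) (by omega) (by omega) (by omega)
          calc min (Real.sqrt θ₀) τ ≤ (1 + M₁) ^ n * (deBruijnZeroZ t b - deBruijnZeroZ t (a - 1)) := h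
            _ ≤ (1 + M₁) ^ n * ((1 + M₁) * δ) := by
                refine mul_le_mul_of_nonneg_left ?_ (pow_nonneg (by linarith) n)
                rw [hδ]; linarith
            _ = (1 + M₁) ^ (n + 1) * δ := by ring
        · rw [min_eq_right hR] at hst
          have h := ih a (b + 1) (by omega) (by omega) (by omega) (by omega)
          calc min (Real.sqrt θ₀) τ ≤ (1 + M₁) ^ n * (deBruijnZeroZ t (b + 1) - deBruijnZeroZ t a) := h
            _ ≤ (1 + M₁) ^ n * ((1 + M₁) * δ) := by
                refine mul_le_mul_of_nonneg_left ?_ (pow_nonneg (by linarith) n)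
                rw [hδ]; linarith
            _ = (1 + M₁) ^ (n + 1) * δ := by ring

end Iteration

/-! ## §D. The terminal lower bound (FMP p. 38: «… in the second case, we have
`δ(K_r) ≫ log⁻⁶ ξ_j`»; here: an interval `[a', b']` of width
`≥ (2Λ/c₂)(1 + 2BΛ)`, `Λ = C₁ log₊ hi ≥ log₊ ξ_{b'}`, has diameter `≥ 1`, from (50) and Lemma 8 (ii)
— the source uses (52) instead) -/

section Terminal

variable {t B C₁ c₂ : ℝ}

/-- **Wide intervals have diameter at least `1`.** [cite: RodgersTaoFMP2020, §5 p. 38 (lower bound for `δ(K_r)`)] -/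
theorem one_le_diam_of_wide (hB : 0 ≤ B)
    (h50 : ∀ j : ℤ, 1 ≤ j →
      |deBruijnZeroZ t j - classicalLocation (j : ℝ)| ≤ B * logPlus (classicalLocation (j : ℝ)))
    (hC₁ : 0 < C₁) (hord : ∀ y : ℝ, 1 ≤ y → logPlus (classicalLocation y) ≤ C₁ * logPlus y)
    (hc₂ : 0 < c₂)
    (hii : ∀ j k : ℤ, 1 ≤ j → j ≤ k →
      c₂ * (((k : ℝ) - j) / logPlus (classicalLocation (j : ℝ) + classicalLocation (k : ℝ))) ≤
        classicalLocation (k : ℝ) - classicalLocation (j : ℝ))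
    {a' b' hi : ℤ} (ha' : 1 ≤ a') (hab : a' ≤ b') (hb' : b' ≤ hi)
    (hw : 2 * (C₁ * logPlus hi) * (1 + 2 * B * (C₁ * logPlus hi)) ≤ c₂ * ((b' : ℝ) - a')) :
    1 ≤ deBruijnZeroZ t b' - deBruijnZeroZ t a' := by
  set Λ : ℝ := C₁ * logPlus hi with hΛdef
  have hb1 : (1 : ℤ) ≤ b' := by omega
  have haR : (1 : ℝ) ≤ a' := by exact_mod_cast ha'
  have habR : (a' : ℝ) ≤ b' := by exact_mod_cast hab
  have hbR : (1 : ℝ) ≤ b' := by exact_mod_cast hb1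
  set Lb : ℝ := logPlus (classicalLocation (b' : ℝ)) with hLb
  have hLb0 : 0 < Lb := logPlus_pos _
  have hLbΛ : Lb ≤ Λ := by
    refine (hord (b' : ℝ) hbR).trans (mul_le_mul_of_nonneg_left (logPlus_mono ?_) hC₁.le)
    rw [abs_of_pos (by linarith), abs_of_pos (by exact_mod_cast (show (0 : ℤ) < hi by omega))]
    exact_mod_cast hb'
  have hΛ0 : 0 < Λ := hLb0.trans_le hLbΛ
  have hw0 : 0 ≤ (b' : ℝ) - a' := by linarith
  have h1 := hii a' b' ha' hab
  have h2 : logPlus (classicalLocation (a' : ℝ) + classicalLocation (b' : ℝ)) ≤ 2 * Lb :=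
    logPlus_classicalLocation_add_le haR habR
  have h3 : c₂ * ((b' : ℝ) - a') / (2 * Λ) ≤ classicalLocation (b' : ℝ) - classicalLocation (a' : ℝ) := by
    refine le_trans ?_ h1
    rw [mul_div_assoc]
    exact mul_le_mul_of_nonneg_left
      (div_le_div_of_nonneg_left hw0 (logPlus_pos _) (h2.trans (by linarith))) hc₂.le
  have h4 := h50 b' hb1
  have h5 := h50 a' ha'
  have h6 : logPlus (classicalLocation (a' : ℝ)) ≤ Lb := logPlus_classicalLocation_mono haR habR
  have h7 : c₂ * ((b' : ℝ) - a') / (2 * Λ) - 2 * B * Λ ≤ deBruijnZeroZ t b' - deBruijnZeroZ t a' := by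
    obtain ⟨h4a, h4b⟩ := abs_le.1 h4
    obtain ⟨h5a, h5b⟩ := abs_le.1 h5
    have e1 : B * logPlus (classicalLocation (a' : ℝ)) ≤ B * Λ :=
      mul_le_mul_of_nonneg_left (h6.trans hLbΛ) hB
    have e2 : B * Lb ≤ B * Λ := mul_le_mul_of_nonneg_left hLbΛ hB
    linarith
  have h8 : 1 + 2 * B * Λ ≤ c₂ * ((b' : ℝ) - a') / (2 * Λ) := by
    rw [le_div_iff₀ (by positivity)]; linarith
  linarith

end Terminal


/-! ## §E. Proposition 13 for large `j` («It thus suffices to show that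
`log(1/|x_{j+1} − x_j|) ≪ (log² j) log log j` for large positive `j`», FMP p. 37) -/

section LargeJ

/-- `log₊ b ≤ log₊ c` for integers `1 ≤ b ≤ c`. [cite: RodgersTaoFMP2020, §1.2 p. 7] -/
theorem logPlus_int_mono {b c : ℤ} (hb : 1 ≤ b) (hbc : b ≤ c) : logPlus b ≤ logPlus c :=
  logPlus_mono (by
    rw [abs_of_pos (by exact_mod_cast (show (0 : ℤ) < b by omega)),
      abs_of_pos (by exact_mod_cast (show (0 : ℤ) < c by omega))]
    exact_mod_cast hbc)

/-- From `μ ≤ Rᴺ g` (`μ, g > 0`, `R ≥ 1`) to `−log g ≤ N log R − log μ`. [folklore] -/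
private theorem neg_log_le_of_le_pow_mul {μ R g : ℝ} {N : ℕ} (hμ : 0 < μ) (hR : 1 ≤ R) (hg : 0 < g)
    (h : μ ≤ R ^ N * g) : -Real.log g ≤ N * Real.log R - Real.log μ := by
  have h1 := Real.log_le_log hμ h
  rw [Real.log_mul (by positivity) hg.ne', Real.log_pow] at h1
  linarith

/-- Bookkeeping: the number of steps `⌈C_N log₊² j⌉ ≤ j − 2` once `j ≥ 4096 C_N² + 6`.
[cite: RodgersTaoFMP2020, §5 p. 38 («`|K_i| ≤ r + 1 ≪ log² j` and `k_{+,i} ≤ j + r ≪ j`»)] -/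
theorem steps_le_aux {CN ℓ j : ℝ} (hCN : 0 ≤ CN) (hj : 4096 * CN ^ 2 + 6 ≤ j)
    (hℓ : ℓ ^ 2 ≤ 32 * Real.sqrt j) : CN * ℓ ^ 2 + 1 ≤ j - 2 := by
  have hj0 : 0 ≤ j := by nlinarith
  have h2 : 64 * CN ≤ Real.sqrt j := by
    have e1 : Real.sqrt (4096 * CN ^ 2) = 64 * CN := by
      rw [show (4096 : ℝ) * CN ^ 2 = (64 * CN) ^ 2 by ring, Real.sqrt_sq (by positivity)]
    rw [← e1]
    exact Real.sqrt_le_sqrt (by linarith)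
  have hs : Real.sqrt j * Real.sqrt j = j := Real.mul_self_sqrt hj0
  have e1 : CN * ℓ ^ 2 ≤ CN * (32 * Real.sqrt j) := mul_le_mul_of_nonneg_left hℓ hCN
  have e2 : 64 * CN * Real.sqrt j ≤ Real.sqrt j * Real.sqrt j :=
    mul_le_mul_of_nonneg_right h2 (Real.sqrt_nonneg _)
  nlinarith

/-- Bookkeeping: the terminal width `1 + ⌈C_N log₊² j⌉` is wide in the sense of
`one_le_diam_of_wide`, with `C_N = 8C₁/c₂ + 16 B C₁²/c₂` and `log₊ hi ≤ 2 log₊ j`.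
[cite: RodgersTaoFMP2020, §5 p. 38] -/
theorem wide_aux {C₁ B c₂ ℓ Lh Nr : ℝ} (hC₁ : 0 < C₁) (hB : 0 ≤ B) (hc₂ : 0 < c₂)
    (hℓ : 1 / 2 ≤ ℓ) (hLh0 : 0 ≤ Lh) (hLh : Lh ≤ 2 * ℓ)
    (hN : (8 * C₁ / c₂ + 16 * B * C₁ ^ 2 / c₂) * ℓ ^ 2 ≤ Nr) :
    2 * (C₁ * Lh) * (1 + 2 * B * (C₁ * Lh)) ≤ c₂ * (1 + Nr) := by
  have f1 : C₁ * Lh ≤ C₁ * (2 * ℓ) := mul_le_mul_of_nonneg_left hLh hC₁.le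
  have f3 : 1 + 2 * B * (C₁ * Lh) ≤ 1 + 2 * B * (C₁ * (2 * ℓ)) := by
    have := mul_le_mul_of_nonneg_left f1 (show (0 : ℝ) ≤ 2 * B by positivity)
    linarith
  have e1 : 2 * (C₁ * Lh) * (1 + 2 * B * (C₁ * Lh)) ≤ 2 * (C₁ * (2 * ℓ)) * (1 + 2 * B * (C₁ * (2 * ℓ))) :=
    mul_le_mul (by linarith) f3 (by positivity) (by positivity)
  have f0 : 2 * (C₁ * (2 * ℓ)) * (1 + 2 * B * (C₁ * (2 * ℓ))) = 4 * C₁ * ℓ + 16 * B * C₁ ^ 2 * ℓ ^ 2 := by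
    ring
  have f4 : c₂ * ((8 * C₁ / c₂ + 16 * B * C₁ ^ 2 / c₂) * ℓ ^ 2) =
      8 * C₁ * ℓ ^ 2 + 16 * B * C₁ ^ 2 * ℓ ^ 2 := by
    field_simp
  have f2 : ℓ ≤ 2 * ℓ ^ 2 := by nlinarith
  have f5 : 4 * C₁ * ℓ ≤ 4 * C₁ * (2 * ℓ ^ 2) := mul_le_mul_of_nonneg_left f2 (by positivity)
  have f6 : c₂ * ((8 * C₁ / c₂ + 16 * B * C₁ ^ 2 / c₂) * ℓ ^ 2) ≤ c₂ * Nr :=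
    mul_le_mul_of_nonneg_left hN hc₂.le
  nlinarith

/-- Bookkeeping: the growth factor of one step is polylogarithmic,
`Φ(hi) ≤ E₁ (2 + log₊ j)²` with `E₁ = 16D + 8192D² + 1296B⁴ + 15`, when `log₊ hi ≤ 2 log₊ j`.
[cite: RodgersTaoFMP2020, §5 p. 38 («`δ(K_{i+1}) ≪ j log² j δ(K_i)`»)] -/
theorem phi_aux {D B Lh ℓ : ℝ} (hD : 0 ≤ D) (hℓ : 0 < ℓ) (hLh0 : 0 ≤ Lh) (hLh : Lh ≤ 2 * ℓ) :
    2 * ((⌈2 * D * Lh ^ 2⌉₊ + ⌈4096 * D ^ 2⌉₊ + ⌈Lh ^ 2⌉₊ : ℕ) : ℝ) + (⌈1296 * B ^ 4⌉₊ : ℝ) ≤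
      (16 * D + 8192 * D ^ 2 + 1296 * B ^ 4 + 15) * (2 + ℓ) ^ 2 := by
  have h1 : Lh ^ 2 ≤ 4 * ℓ ^ 2 := by nlinarith
  have c1 : (⌈2 * D * Lh ^ 2⌉₊ : ℝ) < 2 * D * Lh ^ 2 + 1 := Nat.ceil_lt_add_one (by positivity)
  have c2 : (⌈4096 * D ^ 2⌉₊ : ℝ) < 4096 * D ^ 2 + 1 := Nat.ceil_lt_add_one (by positivity)
  have c3 : (⌈Lh ^ 2⌉₊ : ℝ) < Lh ^ 2 + 1 := Nat.ceil_lt_add_one (by positivity)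
  have c4 : (⌈1296 * B ^ 4⌉₊ : ℝ) < 1296 * B ^ 4 + 1 := Nat.ceil_lt_add_one (by positivity)
  push_cast
  have g1 : D * Lh ^ 2 ≤ D * (4 * ℓ ^ 2) := mul_le_mul_of_nonneg_left h1 hD
  have p1 : 0 ≤ (8192 * D ^ 2 + 1296 * B ^ 4 + 7) * ℓ ^ 2 := by positivity
  have p2 : 0 ≤ (16 * D + 8192 * D ^ 2 + 1296 * B ^ 4 + 15) * ℓ := by positivity
  have p3 : 0 ≤ 64 * D + 3 * (8192 * D ^ 2) + 3 * (1296 * B ^ 4) + 53 := by positivity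
  have e : (16 * D + 8192 * D ^ 2 + 1296 * B ^ 4 + 15) * (2 + ℓ) ^ 2 =
      (16 * D * ℓ ^ 2 + 8 * ℓ ^ 2 + 8192 * D ^ 2 + 1296 * B ^ 4 + 7) +
      ((8192 * D ^ 2 + 1296 * B ^ 4 + 7) * ℓ ^ 2 +
        4 * ((16 * D + 8192 * D ^ 2 + 1296 * B ^ 4 + 15) * ℓ) +
        (64 * D + 3 * (8192 * D ^ 2) + 3 * (1296 * B ^ 4) + 53)) := by ring
  nlinarith

/-- Bookkeeping of the logarithms: from `−log g ≤ N·R − log μ` with `N ≤ C_N ℓ² + 1`,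
`0 ≤ R ≤ κ + 2λ`, `−log μ ≤ |L|`, `ℓ, λ ≥ ½`, conclude
`−log g ≤ ((C_N + 4)(2κ + 2) + 8|L|) ℓ² λ`. [folklore] -/
private theorem log_bookkeeping_aux {CN κ L ℓ lam Nr R g μ : ℝ} (hCN : 0 ≤ CN) (hκ : 0 ≤ κ)
    (hℓ : 1 / 2 ≤ ℓ) (hlam : 1 / 2 ≤ lam) (hN : Nr ≤ CN * ℓ ^ 2 + 1) (hR : R ≤ κ + 2 * lam)
    (hR0 : 0 ≤ R) (hlog : -Real.log g ≤ Nr * R - Real.log μ) (hμ : -Real.log μ ≤ |L|) :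
    -Real.log g ≤ ((CN + 4) * (2 * κ + 2) + 8 * |L|) * (ℓ ^ 2 * lam) := by
  have hℓsq : 1 / 4 ≤ ℓ ^ 2 := by nlinarith
  have hmain : Nr * R ≤ (CN * ℓ ^ 2 + 1) * (κ + 2 * lam) :=
    mul_le_mul hN hR hR0 (by positivity)
  have f1 : CN * ℓ ^ 2 + 1 ≤ (CN + 4) * ℓ ^ 2 := by linarith
  have f2 : κ + 2 * lam ≤ (2 * κ + 2) * lam := by
    have e1 := mul_le_mul_of_nonneg_left (show (1 : ℝ) ≤ 2 * lam by linarith) hκ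
    have e2 : (2 * κ + 2) * lam = κ * (2 * lam) + 2 * lam := by ring
    rw [e2]; linarith
  have f3 : (CN * ℓ ^ 2 + 1) * (κ + 2 * lam) ≤ ((CN + 4) * ℓ ^ 2) * ((2 * κ + 2) * lam) :=
    mul_le_mul f1 f2 (by positivity) (by positivity)
  have f4 : |L| ≤ 8 * |L| * (ℓ ^ 2 * lam) := by
    have e1 : 1 / 4 * (1 / 2) ≤ ℓ ^ 2 * lam := mul_le_mul hℓsq hlam (by norm_num) (by positivity)
    have e2 := mul_le_mul_of_nonneg_left (show (1 : ℝ) ≤ 8 * (ℓ ^ 2 * lam) by linarith)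
      (abs_nonneg L)
    have e3 : 8 * |L| * (ℓ ^ 2 * lam) = |L| * (8 * (ℓ ^ 2 * lam)) := by ring
    rw [e3]; linarith
  have e : ((CN + 4) * (2 * κ + 2) + 8 * |L|) * (ℓ ^ 2 * lam) =
      ((CN + 4) * ℓ ^ 2) * ((2 * κ + 2) * lam) + 8 * |L| * (ℓ ^ 2 * lam) := by ring
  rw [e]; linarith

set_option maxHeartbeats 400000 in
/-- **Proposition 13 (lower bound on gaps), consecutive gaps, large `j` — RH-free CONTENT.** For
`B ≥ 0` and `0 < c_K` there are `J` and `A ≥ 0` such that at every time `t > Λ` at which Lemma 14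
holds with constant `c_K` and the location law (50) holds with constant `B`, one has
`−log(x_{j+1}(t) − x_j(t)) ≤ A log₊² j · log₊ log₊ j` for all `j ≥ J`. The constants are uniform
in `t`. Proof: the printed enlargement iteration (§§B–D above) run `⌈C_N log₊² j⌉` times.
[cite: RodgersTaoFMP2020, Proposition 13 = v4 Prop. 5.1, proof pp. 37–38] -/
theorem exists_neg_log_gap_le_of_large (B cK : ℝ) (hB : 0 ≤ B) (hcK : 0 < cK) :
    ∃ (J : ℕ) (A : ℝ), 0 ≤ A ∧ ∀ t : ℝ, (∃ t₁ : ℝ, t₁ < t ∧ HasOnlyRealZeros (deBruijnH t₁)) →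
      (∀ K : Finset ℤ, (0 : ℤ) ∉ K → 2 ≤ K.card →
        cK * (K.card : ℝ) ^ 3 / (1 + ∑ k ∈ K, ∑' j : zstarCompl K, interactionEnergy t j k) ≤
          ∑ p ∈ K.offDiag, (deBruijnZeroZ t p.1 - deBruijnZeroZ t p.2) ^ 2) →
      (∀ n : ℕ, 1 ≤ n →
        |deBruijnZero t n - classicalLocation (n : ℝ)| ≤ B * logPlus (classicalLocation (n : ℝ))) →
      ∀ j : ℤ, (J : ℤ) ≤ j →
        -Real.log (deBruijnZeroZ t (j + 1) - deBruijnZeroZ t j) ≤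
          A * (logPlus j ^ 2 * logPlus (logPlus j)) := by
  obtain ⟨c₁, C₁, hc₁, hc₁C₁, hordall⟩ := lemma8_i_order
  have hC₁ : 0 < C₁ := hc₁.trans_le hc₁C₁
  have hordl : ∀ y : ℝ, 1 ≤ y → c₁ * (y / logPlus y) ≤ classicalLocation y := fun y hy ↦ (hordall y hy).1
  have hord : ∀ y : ℝ, 1 ≤ y → logPlus (classicalLocation y) ≤ C₁ * logPlus y :=
    fun y hy ↦ (hordall y hy).2.2.2
  obtain ⟨c₂, hc₂, hii⟩ := lemma8_ii_pos
  obtain ⟨S₀, hS₀0, hS₀⟩ := exists_sum_logPlus_sq_div_sq_le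
  set D : ℝ := 16 * B * C₁ ^ 2 / c₂ with hD
  have hD0 : 0 ≤ D := by rw [hD]; positivity
  obtain ⟨Φ, hΦ⟩ : ∃ Φ : ℤ → ℝ, ∀ b : ℤ, Φ b =
      (2 * ((⌈2 * (16 * B * C₁ ^ 2 / c₂) * logPlus b ^ 2⌉₊ + ⌈4096 * (16 * B * C₁ ^ 2 / c₂) ^ 2⌉₊ +
          ⌈logPlus b ^ 2⌉₊ : ℕ) : ℝ) + (⌈1296 * B ^ 4⌉₊ : ℝ)) := ⟨_, fun b ↦ rfl⟩
  have hΦ0 : ∀ b, 0 ≤ Φ b := fun b ↦ by rw [hΦ]; positivity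
  set C' : ℝ := 32 * C₁ ^ 2 / c₂ ^ 2 * (2 + S₀) + 4 / c₁ ^ 2 * S₀ with hC'
  have hC'0 : 0 ≤ C' := by rw [hC']; positivity
  set θ₀ : ℝ := cK / (2 * (C' + 1)) with hθ₀
  have hθ₀0 : 0 < θ₀ := by rw [hθ₀]; positivity
  set CN : ℝ := 8 * C₁ / c₂ + 16 * B * C₁ ^ 2 / c₂ with hCN
  have hCN0 : 0 ≤ CN := by rw [hCN]; positivity
  set E₁ : ℝ := 16 * D + 8192 * D ^ 2 + 1296 * B ^ 4 + 15 with hE₁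
  have hE₁0 : 0 ≤ E₁ := by rw [hE₁]; positivity
  set κ : ℝ := Real.log (2 * E₁ / cK + 2) with hκ
  have hκ0 : 0 ≤ κ := by
    have h0 : (0 : ℝ) ≤ 2 * E₁ / cK := by positivity
    exact Real.log_nonneg (by linarith)
  set A : ℝ := (CN + 4) * (2 * κ + 2) + 8 * |Real.log θ₀| with hA
  refine ⟨⌈4096 * CN ^ 2⌉₊ + 6, A, by positivity, ?_⟩
  intro t hΛ hL14 h50N j hj
  have hsm := strictMono_deBruijnZeroZ hΛ
  have h50 : ∀ j : ℤ, 1 ≤ j →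
      |deBruijnZeroZ t j - classicalLocation (j : ℝ)| ≤ B * logPlus (classicalLocation (j : ℝ)) :=
    fun j hj ↦ location_int_of_nat h50N hj
  -- the scale ℓ = log₊ j and the number of steps N
  have hj6 : (6 : ℤ) ≤ j := by omega
  have hjR : (6 : ℝ) ≤ j := by exact_mod_cast hj6
  have hjR' : 4096 * CN ^ 2 + 6 ≤ (j : ℝ) := by
    have h1 := Nat.le_ceil (4096 * CN ^ 2)
    have h3 : ((⌈4096 * CN ^ 2⌉₊ : ℕ) : ℝ) + 6 ≤ j := by exact_mod_cast hj
    linarith only [h1, h3]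
  set ℓ : ℝ := logPlus j with hℓ
  have hℓ2 : Real.log 2 ≤ ℓ := log_two_le_logPlus _
  have hlog2 : (1 : ℝ) / 2 < Real.log 2 := by
    have := Real.log_two_gt_d9; linarith only [this]
  have hℓhalf : 1 / 2 ≤ ℓ := by linarith only [hℓ2, hlog2]
  have hℓ0 : 0 < ℓ := by linarith only [hℓhalf]
  set N : ℕ := ⌈CN * ℓ ^ 2⌉₊ with hN
  have hNR : (N : ℝ) < CN * ℓ ^ 2 + 1 := Nat.ceil_lt_add_one (by positivity)
  have hNge : CN * ℓ ^ 2 ≤ N := Nat.le_ceil _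
  have hNj : (N : ℤ) ≤ j - 2 := by
    have h1 := steps_le_aux hCN0 hjR' (logPlus_sq_le_sqrt_nat (by linarith only [hjR]))
    have h4 : (N : ℝ) ≤ (j : ℝ) - 2 := by linarith only [h1, hNR]
    exact_mod_cast h4
  set lo : ℤ := j - N with hlo
  set hi : ℤ := j + 1 + N with hhi
  have hlo2 : 2 ≤ lo := by omega
  have hLhi : logPlus hi ≤ 2 * ℓ := by
    have hNj' : (N : ℝ) ≤ j - 2 := by exact_mod_cast hNj
    calc logPlus (hi : ℝ) ≤ logPlus (2 * (j : ℝ) + 1) := logPlus_mono (by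
            rw [abs_of_pos (by exact_mod_cast (show (0 : ℤ) < hi by omega)),
              abs_of_pos (by linarith only [hjR])]
            have e : (hi : ℝ) = j + 1 + N := by rw [hhi]; push_cast; ring
            rw [e]
            linarith only [hNj'])
      _ ≤ 2 * ℓ := logPlus_two_mul_add_one_le (by linarith only [hjR])
  -- §A at time t
  have hAt : ∀ a b k : ℤ, 2 ≤ a → a ≤ k → k ≤ b → ∀ m : ℝ, 0 < m →
      m ≤ deBruijnZeroZ t a - deBruijnZeroZ t (a - 1) →
      m ≤ deBruijnZeroZ t (b + 1) - deBruijnZeroZ t b →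
      ∑' j : zstarCompl (zstarIcc a b), interactionEnergy t j k ≤ Φ b / m ^ 2 + C' := by
    intro a b k ha hak hkb m hm hmL hmR
    rw [hΦ, hC']
    exact crossEnergy_interval_le hΛ hB h50 hc₁ hordl hC₁ hord hc₂ hii hS₀ ha hak hkb hm hmL hmR
  -- monotonicity of Φ and the growth factor M₁
  have hΦmono : ∀ b : ℤ, 1 ≤ b → b ≤ hi → Φ b ≤ Φ hi := by
    intro b hb hbhi
    rw [hΦ, hΦ]
    have h1 : logPlus (b : ℝ) ^ 2 ≤ logPlus (hi : ℝ) ^ 2 :=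
      pow_le_pow_left₀ (logPlus_nonneg _) (logPlus_int_mono hb hbhi) 2
    have h2 : (⌈2 * (16 * B * C₁ ^ 2 / c₂) * logPlus (b : ℝ) ^ 2⌉₊ : ℝ) ≤
        ⌈2 * (16 * B * C₁ ^ 2 / c₂) * logPlus (hi : ℝ) ^ 2⌉₊ := by
      rw [← hD]
      exact_mod_cast Nat.ceil_mono (mul_le_mul_of_nonneg_left h1 (by positivity))
    have h3 : (⌈logPlus (b : ℝ) ^ 2⌉₊ : ℝ) ≤ ⌈logPlus (hi : ℝ) ^ 2⌉₊ := by
      exact_mod_cast Nat.ceil_mono h1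
    push_cast
    linarith only [h2, h3]
  set M₁ : ℝ := 2 * Φ hi / cK + 1 with hM₁
  have hM₁0 : 0 ≤ M₁ := by have := hΦ0 hi; positivity
  have hstep : ∀ a b : ℤ, lo ≤ a → a < b → b ≤ hi →
      (deBruijnZeroZ t b - deBruijnZeroZ t a) ^ 2 ≤ θ₀ →
      min (deBruijnZeroZ t a - deBruijnZeroZ t (a - 1))
          (deBruijnZeroZ t (b + 1) - deBruijnZeroZ t b) ≤
        M₁ * (deBruijnZeroZ t b - deBruijnZeroZ t a) := by
    intro a b hloa hab hbhi hδ
    have h := outerGap_le_of_diam_small hΛ hcK hL14 hΦ0 hC'0 hAt (by omega) hab hδ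
    refine h.trans (mul_le_mul_of_nonneg_right ?_ (sub_pos.2 (hsm hab)).le)
    have := hΦmono b (by omega) hbhi
    rw [hM₁]
    gcongr
  -- terminal lower bound
  have hterm : ∀ a' b' : ℤ, lo ≤ a' → b' ≤ hi → b' - a' = 1 + N →
      1 ≤ deBruijnZeroZ t b' - deBruijnZeroZ t a' := by
    intro a' b' ha' hb' hw
    refine one_le_diam_of_wide hB h50 hC₁ hord hc₂ hii (by omega) (by omega) hb' ?_
    have hw' : (b' : ℝ) - a' = 1 + N := by exact_mod_cast hw
    rw [hw']
    exact wide_aux hC₁ hB hc₂ hℓhalf (logPlus_nonneg _) hLhi (by rw [← hCN]; exact hNge)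
  -- the iteration
  have hiter := min_le_growth_pow_mul_diam hΛ hM₁0 hstep hterm N j (j + 1) (by omega) (by omega)
    (by omega) (by ring)
  have hg0 : 0 < deBruijnZeroZ t (j + 1) - deBruijnZeroZ t j := sub_pos.2 (hsm (by omega))
  have hμ0 : 0 < min (Real.sqrt θ₀) 1 := lt_min (Real.sqrt_pos.2 hθ₀0) one_pos
  have hlog := neg_log_le_of_le_pow_mul hμ0 (by linarith only [hM₁0]) hg0 hiter
  -- bookkeeping of the logarithms
  have hμlog : -Real.log (min (Real.sqrt θ₀) 1) ≤ |Real.log θ₀| := by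
    rcases le_or_gt (Real.sqrt θ₀) 1 with h1 | h1
    · rw [min_eq_left h1, Real.log_sqrt hθ₀0.le]
      have e1 := neg_abs_le (Real.log θ₀)
      have e2 := abs_nonneg (Real.log θ₀)
      linarith only [e1, e2]
    · rw [min_eq_right h1.le, Real.log_one, neg_zero]; exact abs_nonneg _
  have hΦhi : Φ hi ≤ E₁ * (2 + ℓ) ^ 2 := by
    rw [hΦ, ← hD, hE₁]
    exact phi_aux hD0 hℓ0 (logPlus_nonneg _) hLhi
  have hM₁log : Real.log (1 + M₁) ≤ κ + 2 * logPlus ℓ := by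
    have h1 : 1 + M₁ ≤ (2 * E₁ / cK + 2) * (2 + ℓ) ^ 2 := by
      rw [hM₁]
      have e1 : 2 * Φ hi / cK ≤ 2 * (E₁ * (2 + ℓ) ^ 2) / cK := by gcongr
      have e2 : 1 ≤ (2 + ℓ) ^ 2 := by nlinarith only [hℓ0]
      have e3 : 2 * (E₁ * (2 + ℓ) ^ 2) / cK = 2 * E₁ / cK * (2 + ℓ) ^ 2 := by ring
      have e4 : (2 * E₁ / cK + 2) * (2 + ℓ) ^ 2 = 2 * E₁ / cK * (2 + ℓ) ^ 2 + 2 * (2 + ℓ) ^ 2 := by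
        ring
      rw [e4]
      rw [e3] at e1
      linarith only [e1, e2]
    have h2 : 0 < 1 + M₁ := by linarith only [hM₁0]
    calc Real.log (1 + M₁) ≤ Real.log ((2 * E₁ / cK + 2) * (2 + ℓ) ^ 2) := Real.log_le_log h2 h1
      _ = κ + 2 * logPlus ℓ := by
          rw [Real.log_mul (by positivity) (by positivity), Real.log_pow, hκ, logPlus_eq,
            abs_of_pos hℓ0]
          push_cast; ring
  have hM₁log0 : 0 ≤ Real.log (1 + M₁) := Real.log_nonneg (by linarith only [hM₁0])
  have hlam : 1 / 2 ≤ logPlus ℓ := by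
    have := log_two_le_logPlus ℓ; linarith only [this, hlog2]
  rw [hA]
  exact log_bookkeeping_aux hCN0 hκ0 hℓhalf hlam hNR.le hM₁log hM₁log0 hlog hμlog

end LargeJ


/-! ## §F. From consecutive gaps to `max_{k ≠ j} H_{jk}`, symmetry `j ↦ −j`, and «the claim follows
from compactness for bounded `j`» (FMP p. 37) -/

section Assembly

/-- Every other zero is at least a neighbouring gap away: for `j ≥ 1` and `k ≠ j`,
`min(x_{j+1} − x_j, x_j − x_{j−1}) ≤ |x_j − x_k|` (with `x_0 = 0`, which also covers `k ≤ −1`).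
[cite: RodgersTaoFMP2020, §5 p. 37 («`min_{j ∉ K}|x_k − x_j| ≥ min(|x_{k₋} − x_{k₋−1}|, |x_{k₊} − x_{k₊+1}|)`»)] -/
theorem hamiltonianInteraction_le_neg_log {t : ℝ}
    (hΛ : ∃ t₁ : ℝ, t₁ < t ∧ HasOnlyRealZeros (deBruijnH t₁)) {j k : ℤ} (hkj : k ≠ j) {m : ℝ}
    (hm : 0 < m) (hmR : m ≤ deBruijnZeroZ t (j + 1) - deBruijnZeroZ t j)
    (hmL : m ≤ deBruijnZeroZ t j - deBruijnZeroZ t (j - 1)) :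
    hamiltonianInteraction t j k ≤ -Real.log m := by
  have hmono := (strictMono_deBruijnZeroZ hΛ).monotone
  have h : m ≤ |deBruijnZeroZ t j - deBruijnZeroZ t k| := by
    rcases lt_or_gt_of_ne hkj with h | h
    · rw [abs_of_nonneg (by linarith [hmono h.le])]
      linarith [hmono (show k ≤ j - 1 by omega)]
    · rw [abs_of_nonpos (by linarith [hmono h.le])]
      linarith [hmono (show j + 1 ≤ k by omega)]
  rw [hamiltonianInteraction_eq_neg_log]
  exact neg_le_neg (Real.log_le_log hm h)

/-- `H_{(−j)(−k)} = H_{jk}` (odd symmetry of the zero set, §1.2).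
[cite: RodgersTaoFMP2020, §4 (57) p. 29] -/
theorem hamiltonianInteraction_neg_neg (t : ℝ) (j k : ℤ) :
    hamiltonianInteraction t (-j) (-k) = hamiltonianInteraction t j k := by
  rw [hamiltonianInteraction_eq, hamiltonianInteraction_eq, deBruijnZeroZ_neg, deBruijnZeroZ_neg,
    show -deBruijnZeroZ t j - -deBruijnZeroZ t k = -(deBruijnZeroZ t j - deBruijnZeroZ t k) by ring,
    abs_neg]

/-- `log₊² j · log₊ log₊ j ≥ log³ 2 > 0`: the normalising function of (59) is bounded below.
[cite: RodgersTaoFMP2020, Proposition 13 (59)] -/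
theorem log_two_cube_le_logPlus_sq_mul (x : ℝ) :
    Real.log 2 ^ 2 * Real.log 2 ≤ logPlus x ^ 2 * logPlus (logPlus x) := by
  have h1 : Real.log 2 ≤ logPlus x := log_two_le_logPlus x
  have h2 : Real.log 2 ≤ logPlus (logPlus x) := log_two_le_logPlus _
  have h0 : 0 ≤ Real.log 2 := (Real.log_pos one_lt_two).le
  exact mul_le_mul (pow_le_pow_left₀ h0 h1 2) h2 h0 (by positivity)

/-- «Compactness for bounded `j`»: on a compact time interval `[t₁, t₂]` above a real-rooted time
`t₀`, the finitely many gaps `x_{n+1}(t) − x_n(t)`, `0 ≤ n ≤ J`, have a common positive lower bound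
(continuity of the zeros in `t`, `continuousAt_deBruijnZero`, and their strict ordering).
[cite: RodgersTaoFMP2020, §5 p. 37 («the claim follows from compactness for bounded `j`»)] -/
theorem exists_uniform_gap_lower {t₀ t₁ t₂ : ℝ} (h01 : t₀ < t₁)
    (hreal : HasOnlyRealZeros (deBruijnH t₀)) (J : ℕ) :
    ∃ g₀ : ℝ, 0 < g₀ ∧ ∀ t ∈ Icc t₁ t₂, ∀ n : ℕ, n ≤ J →
      g₀ ≤ deBruijnZero t (n + 1) - deBruijnZero t n := by
  have hΛ : ∀ t ∈ Icc t₁ t₂, ∃ t' : ℝ, t' < t ∧ HasOnlyRealZeros (deBruijnH t') :=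
    fun t ht ↦ ⟨t₀, by linarith [ht.1], hreal⟩
  -- one gap at a time
  have single : ∀ n : ℕ, ∃ g : ℝ, 0 < g ∧ ∀ t ∈ Icc t₁ t₂,
      g ≤ deBruijnZero t (n + 1) - deBruijnZero t n := by
    intro n
    rcases le_or_gt t₁ t₂ with h12 | h12
    · have hcont : ContinuousOn (fun t ↦ deBruijnZero t (n + 1) - deBruijnZero t n) (Icc t₁ t₂) :=
        fun t ht ↦ ((continuousAt_deBruijnZero (hΛ t ht) (n + 1)).sub
          (continuousAt_deBruijnZero (hΛ t ht) n)).continuousWithinAt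
      obtain ⟨s, hs, hmin⟩ := isCompact_Icc.exists_isMinOn (nonempty_Icc.2 h12) hcont
      refine ⟨deBruijnZero s (n + 1) - deBruijnZero s n,
        sub_pos.2 (strictMono_deBruijnZero (hΛ s hs) (Nat.lt_succ_self n)), fun t ht ↦ ?_⟩
      exact hmin ht
    · exact ⟨1, one_pos, fun t ht ↦ absurd (ht.1.trans ht.2) (not_le.2 h12)⟩
  induction J with
  | zero =>
      obtain ⟨g, hg, h⟩ := single 0
      exact ⟨g, hg, fun t ht n hn ↦ by rw [Nat.le_zero.1 hn]; exact h t ht⟩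
  | succ J ih =>
      obtain ⟨g₀, hg₀, h₀⟩ := ih
      obtain ⟨g, hg, h⟩ := single (J + 1)
      refine ⟨min g₀ g, lt_min hg₀ hg, fun t ht n hn ↦ ?_⟩
      rcases Nat.lt_or_ge n (J + 1) with hn' | hn'
      · exact (min_le_left _ _).trans (h₀ t ht n (by omega))
      · rw [show n = J + 1 by omega]
        exact (min_le_right _ _).trans (h t ht)

/-- **Rodgers–Tao 2020, Proposition 13 (= v4 Prop. 5.1, lower bound on gaps) — RH-FREE CONTENT,
house (time-translated) SCHEMA form.** Let `t₀ < t₁` with `H_{t₀}` real-rooted (so `Λ ≤ t₀`), and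
suppose the macroscopic location law (50) `|x_j(t) − ξ_j| ≤ B log₊ ξ_j` (`j ≥ 1`) holds at every
time of `[t₁, t₂]`. Then there is `A`, uniform in `t ∈ [t₁, t₂]`, with
`H_{jk}(t) ≤ A · log₊² j · log₊ log₊ j` for all `j, k ∈ ℤ*`, `k ≠ j` — display (59),
`max_{k ∈ ℤ*: k ≠ j} H_{jk}(t) ≪ (log²₊ j) log₊ log₊ j`, i.e. no zero lies within
`exp(−O(log² j · log log j))` of `x_j(t)`.
The printed statement (range `Λ/2 ≤ t ≤ 0`, constants depending on `Λ`, (50) supplied by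
Corollary 10) is the instance `t₀ = Λ`, `[t₁, t₂] = [Λ/2, 0]`: see
`rodgers_tao_gap_bound_of_cor33_location`. Inputs: the kernel Lemma 14
(`rodgers_tao_gap_cross_energy_of_lt`, constant `min((t₁−t₀)/2, 1/64)` on `[t₁, t₂]`), Lemma 8
(`lemma31_i_order_holds`, `lemma31_ii_holds`), continuity and ordering of the zeros
(`continuousAt_deBruijnZero`, `strictMono_deBruijnZeroZ`). Divergence from the printed proof:
display (52) is not used (module docstring).
[cite: RodgersTaoFMP2020, Proposition 13 = v4 Proposition 5.1, p. 34 (59); proof pp. 37–38] -/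
theorem rodgers_tao_gap_bound_of {t₀ t₁ t₂ B : ℝ} (h01 : t₀ < t₁)
    (hreal : HasOnlyRealZeros (deBruijnH t₀))
    (h50 : ∀ t ∈ Icc t₁ t₂, ∀ n : ℕ, 1 ≤ n →
      |deBruijnZero t n - classicalLocation (n : ℝ)| ≤ B * logPlus (classicalLocation (n : ℝ))) :
    ∃ A : ℝ, ∀ t ∈ Icc t₁ t₂, ∀ j k : ℤ, j ≠ 0 → k ≠ 0 → k ≠ j →
      hamiltonianInteraction t j k ≤ A * (logPlus j ^ 2 * logPlus (logPlus j)) := by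
  have hΛ : ∀ t ∈ Icc t₁ t₂, ∃ t' : ℝ, t' < t ∧ HasOnlyRealZeros (deBruijnH t') :=
    fun t ht ↦ ⟨t₀, by linarith [ht.1], hreal⟩
  -- constants: B' = max B 0, c_K = min((t₁ − t₀)/2, 1/64)
  set B' : ℝ := max B 0 with hB'
  have hB'0 : 0 ≤ B' := le_max_right _ _
  have h50' : ∀ t ∈ Icc t₁ t₂, ∀ n : ℕ, 1 ≤ n →
      |deBruijnZero t n - classicalLocation (n : ℝ)| ≤ B' * logPlus (classicalLocation (n : ℝ)) :=
    fun t ht n hn ↦ (h50 t ht n hn).trans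
      (mul_le_mul_of_nonneg_right (le_max_left _ _) (logPlus_nonneg _))
  set cK : ℝ := min ((t₁ - t₀) / 2) (1 / 64) with hcK
  have hcK0 : 0 < cK := lt_min (by linarith) (by norm_num)
  have hL14 : ∀ t ∈ Icc t₁ t₂, ∀ K : Finset ℤ, (0 : ℤ) ∉ K → 2 ≤ K.card →
      cK * (K.card : ℝ) ^ 3 / (1 + ∑ k ∈ K, ∑' j : zstarCompl K, interactionEnergy t j k) ≤
        ∑ p ∈ K.offDiag, (deBruijnZeroZ t p.1 - deBruijnZeroZ t p.2) ^ 2 := by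
    intro t ht K hK0 hK2
    have h := rodgers_tao_gap_cross_energy_of_lt t₀ t (by linarith [ht.1]) hreal K hK0 hK2
    refine le_trans ?_ h
    have hCE : 0 ≤ ∑ k ∈ K, ∑' j : zstarCompl K, interactionEnergy t j k :=
      Finset.sum_nonneg fun k _ ↦ tsum_nonneg fun j ↦ interactionEnergy_nonneg _ _ _
    refine div_le_div_of_nonneg_right (mul_le_mul_of_nonneg_right ?_ (by positivity)) (by positivity)
    exact le_min ((min_le_left _ _).trans (by linarith [ht.1])) (min_le_right _ _)
  obtain ⟨J, A₁, hA₁, hlarge⟩ := exists_neg_log_gap_le_of_large B' cK hB'0 hcK0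
  obtain ⟨g₀, hg₀, hsmall⟩ := exists_uniform_gap_lower (t₂ := t₂) h01 hreal (J + 1)
  set κ₀ : ℝ := Real.log 2 ^ 2 * Real.log 2 with hκ₀
  have hκ₀0 : 0 < κ₀ := by have := Real.log_pos one_lt_two; positivity
  set A₂ : ℝ := max 0 (-Real.log g₀) / κ₀ with hA₂
  have hA₂0 : 0 ≤ A₂ := by positivity
  refine ⟨max A₁ A₂, ?_⟩
  -- the claim for positive j
  have pos : ∀ t ∈ Icc t₁ t₂, ∀ j k : ℤ, 1 ≤ j → k ≠ j →
      hamiltonianInteraction t j k ≤ max A₁ A₂ * (logPlus j ^ 2 * logPlus (logPlus j)) := by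
    intro t ht j k hj hkj
    have hnorm0 : 0 ≤ logPlus (j : ℝ) ^ 2 * logPlus (logPlus j) := by
      have := logPlus_nonneg (logPlus (j : ℝ)); positivity
    rcases le_or_gt ((J : ℤ) + 2) j with hlj | hsj
    · -- large j: both neighbouring gaps from `exists_neg_log_gap_le_of_large`
      have hR := hlarge t (hΛ t ht) (hL14 t ht) (h50' t ht) j (by omega)
      have hL := hlarge t (hΛ t ht) (hL14 t ht) (h50' t ht) (j - 1) (by omega)
      rw [sub_add_cancel] at hL
      have hsm := strictMono_deBruijnZeroZ (hΛ t ht)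
      set gR : ℝ := deBruijnZeroZ t (j + 1) - deBruijnZeroZ t j with hgR
      set gL : ℝ := deBruijnZeroZ t j - deBruijnZeroZ t (j - 1) with hgL
      have hgR0 : 0 < gR := sub_pos.2 (hsm (by omega))
      have hgL0 : 0 < gL := sub_pos.2 (hsm (by omega))
      have hmono : logPlus ((j - 1 : ℤ) : ℝ) ^ 2 * logPlus (logPlus ((j - 1 : ℤ) : ℝ)) ≤
          logPlus (j : ℝ) ^ 2 * logPlus (logPlus j) := by
        have e1 : logPlus ((j - 1 : ℤ) : ℝ) ≤ logPlus (j : ℝ) :=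
          logPlus_int_mono (b := j - 1) (c := j) (by omega) (by omega)
        have e2 : logPlus (logPlus ((j - 1 : ℤ) : ℝ)) ≤ logPlus (logPlus (j : ℝ)) := by
          refine logPlus_mono ?_
          rw [abs_of_nonneg (logPlus_nonneg _), abs_of_nonneg (logPlus_nonneg _)]
          exact e1
        exact mul_le_mul (pow_le_pow_left₀ (logPlus_nonneg _) e1 2) e2 (logPlus_nonneg _)
          (by positivity)
      have hH := hamiltonianInteraction_le_neg_log (hΛ t ht) hkj (lt_min hgR0 hgL0)
        (min_le_left _ _) (min_le_right _ _)
      have hmin : -Real.log (min gR gL) ≤ A₁ * (logPlus j ^ 2 * logPlus (logPlus j)) := by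
        rcases le_total gR gL with h | h
        · rw [min_eq_left h]; exact hR
        · rw [min_eq_right h]; exact hL.trans (mul_le_mul_of_nonneg_left hmono hA₁)
      exact hH.trans (hmin.trans (mul_le_mul_of_nonneg_right (le_max_left _ _) hnorm0))
    · -- bounded j: compactness
      obtain ⟨n, rfl⟩ := Int.eq_ofNat_of_zero_le (show (0 : ℤ) ≤ j by omega)
      obtain ⟨m, rfl⟩ : ∃ m : ℕ, n = m + 1 := ⟨n - 1, by omega⟩
      have h1 := hsmall t ht (m + 1) (by omega)
      have h2 := hsmall t ht m (by omega)
      have hmR : g₀ ≤ deBruijnZeroZ t (((m + 1 : ℕ) : ℤ) + 1) - deBruijnZeroZ t ((m + 1 : ℕ) : ℤ) := by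
        have e : (((m + 1 : ℕ) : ℤ) + 1) = ((m + 1 + 1 : ℕ) : ℤ) := by push_cast; ring
        rw [e, deBruijnZeroZ_natCast, deBruijnZeroZ_natCast]; exact h1
      have hmL : g₀ ≤ deBruijnZeroZ t ((m + 1 : ℕ) : ℤ) - deBruijnZeroZ t (((m + 1 : ℕ) : ℤ) - 1) := by
        have e : (((m + 1 : ℕ) : ℤ) - 1) = ((m : ℕ) : ℤ) := by push_cast; ring
        rw [e, deBruijnZeroZ_natCast, deBruijnZeroZ_natCast]; exact h2
      have hH := hamiltonianInteraction_le_neg_log (hΛ t ht) hkj hg₀ hmR hmL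
      have hb : -Real.log g₀ ≤ A₂ * (logPlus (((m + 1 : ℕ) : ℤ) : ℝ) ^ 2 *
          logPlus (logPlus (((m + 1 : ℕ) : ℤ) : ℝ))) := by
        have e1 : -Real.log g₀ ≤ max 0 (-Real.log g₀) := le_max_right _ _
        have e2 : max 0 (-Real.log g₀) = A₂ * κ₀ := by rw [hA₂]; field_simp
        have e3 := mul_le_mul_of_nonneg_left (log_two_cube_le_logPlus_sq_mul (((m + 1 : ℕ) : ℤ) : ℝ)) hA₂0
        rw [← hκ₀] at e3
        linarith
      exact hH.trans (hb.trans (mul_le_mul_of_nonneg_right (le_max_right _ _) hnorm0))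
  -- all j ∈ ℤ* by the odd symmetry
  intro t ht j k hj hk hkj
  rcases lt_or_gt_of_ne hj with hneg | hpos
  · have h := pos t ht (-j) (-k) (by omega) (by omega)
    rw [hamiltonianInteraction_neg_neg] at h
    push_cast at h
    rwa [logPlus_neg] at h
  · exact pos t ht j k (by omega) hkj

/-- **The printed Proposition 13 follows from the printed Corollary 10 (50)** — the as-printed
reduction (both sides carry the §1.2 standing hypothesis `Λ < 0` as the witness `t₀ < 0`, so both
are VACUOUS-AS-PRINTED in the tree; the implication itself is RH-free content): instance
`[t₁, t₂] = [t₀/2, 0]` of `rodgers_tao_gap_bound_of`, with (50) supplied by `cor33_location`.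
No second `_holds` is recorded for `rodgers_tao_gap_bound` (its EX-FALSO discharge is
`rodgers_tao_gap_bound_holds`). [cite: RodgersTaoFMP2020, Proposition 13 = v4 Proposition 5.1, p. 34 (59)] -/
theorem rodgers_tao_gap_bound_of_cor33_location (h : RodgersTao2020.cor33_location) :
    rodgers_tao_gap_bound := by
  intro t₀ ht₀ hreal
  obtain ⟨A50, hA50⟩ := h
  obtain ⟨A, hA⟩ := rodgers_tao_gap_bound_of (t₁ := t₀ / 2) (t₂ := 0) (B := A50) (by linarith) hreal
    (fun t ht n hn ↦ hA50 t ⟨t₀, by linarith [ht.1], hreal⟩ ht.2 n hn)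
  exact ⟨A, fun t h1 h2 j k hj hk hkj ↦ hA t ⟨h1, h2⟩ j k hj hk hkj⟩

end Assembly

end Literature.NumberTheory.LFunctions

end
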